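import Literature.MathematicalPhysics.QuantumLattice.HubbardLatticeAnalytic
import HarnessLib

/-!
# The Hubbard polymer weights in the gapped regime: Ueltschi's domain `D₂` (`βt²/Δ`, `t/Δ` small)

Ueltschi (1999), Theorem 3.1, second domain: for `0 < μ < U` the free energy of the Hubbard model
is analytic when `βt²/Δ` and `t/Δ` are small, `Δ = min(μ, U - μ)` — "here the inverse temperature
`β` can be large". The tree's `D₁` pipeline (`HubbardPolymerBounds`, `HubbardLatticeActivity`,
`HubbardLatticeAnalytic`) bounds the inclusion–exclusion bond weights `M(K)` by a Cauchy estimate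
whose constant is `e^{‖Σ_b c_b T_b‖}` (`norm_gibbsRatio_le`), useless once `|τ| = βt` is large.
This file supplies the missing estimate and reruns the pipeline on `D₂`:

* **matrix comparison** (`section MatrixComparison`, any finite index type): entrywise
  domination `|(e^X)_{ij}| ≤ (e^Y)_{ij}` when `|X_{ij}| ≤ Y_{ij}` off the diagonal and
  `re X_{ii} ≤ Y_{ii}` (`norm_exp_apply_le_exp_apply_of_re_le`; power series and a scalar shift),
  and for a Metzler matrix `Y` with a positive sub-invariant vector `Y v ≤ κ v` the bound
  `(e^Y)_{ii} ≤ e^κ` (`exp_apply_self_le_of_mulVec_le`), whence `|Tr e^X| ≤ |ι| e^κ`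
  (`norm_trace_exp_le_card_mul_exp`);
* **the hops in the occupation basis** (`bondOp_apply_ne_zero`, `sum_norm_bondOp_apply_mul_le`):
  `T_b = c†_{xσ}c_{yσ}` has entries of modulus `≤ 1` and maps `|s'⟩` to `± |s⟩` only for
  `s' = hopBack b s`; a hop TOGGLES the excitation (= not singly occupied, `IsExcited`,
  `excCount`) of both endpoints (`excCount_hopBack`) — Ueltschi's observation that jumps are the
  ends of the vertical segments where `n_x ∈ {0, 2}` (§3, the loop representation);
* **the gap** (`re_neg_mul_onSiteEnergyAt_le`): `re(-β v_x(s)) ≤ a - δ · 1(x excited)` with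
  `a = re βμ`, `δ = min(re βμ, re βU - re βμ)` (Ueltschi's `z(ℓ) ≤ t^m e^{-Δ|ℓ|}`);
* **the Lyapunov inequality** (`gapCompMatrix_mulVec_le`): for the real comparison matrix `Y` of
  `-βV_A + Σ_b c_b T_b` (`|c_b| ≤ g`, `c` supported on bonds `K` inside `A`, at most `M` bonds of
  `K` at a site) and `v(s) = η^{⌈exc(s)/2⌉}`, `Y v ≤ (a|A| + g|K|η) v` as soon as `gM ≤ δη`,
  `0 < η ≤ 1`: hops out of the singly occupied sector cost `η`, hops at excited sites gain `η⁻¹`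
  but are paid by the gap — the operator form of "each jump is followed by a vertical segment,
  `∫ e^{-Δτ} dτ = 1/Δ`";
* **the gap bounds** `|g(c)| ≤ (2r)^{|A|} e^{g²M|K|/δ}` (`norm_gibbsRatio_le_of_gap'`, no factor
  `e^{‖ΣcT‖}`) and, by the Cauchy estimate with radius `ϱ|τ|`,
  `|M(K)| ≤ ϱ^{-|K|} (2r)^{|supp K|} exp((1+ϱ)²|τ|² · 4Δ · |K|/δ)` for `(1+ϱ) 4Δ |τ| ≤ δ`
  (`norm_bondWeight_le_of_gap`); at real parameters `|τ| = βt`, `δ = βΔ`, so the hypotheses are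
  `t/Δ` small and the exponent is `βt²/Δ` — exactly the shape of `D₂`;
* **smallness and analyticity on `D₂`** (`ℤ²`): the lattice-animal count with the per-bond bound as
  a hypothesis (`sum_norm_siteActivity_mul_exp_le_of_bondWeight_le`), the Kotecký–Preiss smallness
  `isSmallTIActivity_latticeActivity_of_gap` (`ϱ = 2178 e⁹`, `λ = 1/2178`), the open admissible
  complex domain `admissibleSetGap U t` containing the real points `β > 0`, `0 < μ < U`,
  `16(1+ϱ) t < Δ`, `16(1+ϱ)² βt² < Δ` (`mem_admissibleSetGap_of_real`), and the analyticity of the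
  polymer pressure there (`analyticOnNhd_polymerPressure_lattice_gap`). The free energy on `D₂` and
  the discharge of the barrier `StrongCouplingCeilingNarrow` are in
  `Literature/Barriers/HubbardSuperconductivity/StrongCouplingCeilingNarrowProofs.lean`.

Deviation from the printed proof, recorded: Ueltschi bounds the same Duhamel terms through a
space–time LOOP representation (§3, "Proof of Theorem 3.1, domain `D₂`", with the loop integral
`≤ |𝒜| βt²/Δ · 2χ·2e^{2(c+1)}/(1 - 4χe^{c+1}t/Δ)`); here the positivity of the comparison
semigroup and a Lyapunov vector give the same per-bond smallness without time-ordered integrals.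
Constants are not optimised (`ϱ = 2178e⁹`; Ueltschi: `βt²/Δ < 3.68·10⁻⁷(1 - 1.14·10⁴ t/Δ)` on the
cubic lattice). Everything is PROVED; the new definitions are `hopBack`, `IsExcited`, `excCount`,
`gapCompMatrix`, `gapWeight`, `mulVecApplyHom`, `gapRho`, `gapOf`, `admissibleSetGap`.

## Mathlib / tree search

Mathlib: `NormedSpace.exp_series_hasSum_exp'`, `Matrix.exp_add_of_commute`, `algebraMap_exp_comm`,
`HasSum.norm_le_of_bounded`, `hasSum_le`, `Matrix.entryAddMonoidHom`, `ge_of_tendsto`; no entrywise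
comparison / Metzler-matrix lemmas for `Matrix.exp` (`lean search 'Metzler'`, `'exp_apply_nonneg'`:
nothing). Tree: `bondWeight`, `gibbsRatio_eq_div`, `norm_gibbsRatio_le`, `norm_iterDiff_zero_le`,
`siteRatio`, `card_hubbardBonds_mem_verts_le`, `sum_pow_card_connectedCellSets_le`
(`HubbardPolymerBounds`); `creation_apply`, `annihilation_apply`, `orb_eq_orb_iff`
(`FermionOperatorsProofs`); `onSiteSum_eq_diagonal`, `trace_exp_neg_onSiteSum`
(`HubbardBondAlgebra`); `latticeActivity_shiftSet`, `siteActivity_fermionBox`,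
`isSmallTIActivity_latticeActivity` (the `D₁` model of the proofs here; `HubbardLatticeActivity`);
`admissibleSet`, `analyticOnNhd_polymerPressure` (`HubbardLatticeAnalytic`, `PolymerPressureAnalytic`).

## References

* D. Ueltschi, *Analyticity in Hubbard models*, J. Stat. Phys. 95 (1999) 693–717,
  arXiv:cond-mat/9810320: Theorem 3.1 (domain `D₂`), §3 "Proof of Theorem 3.1, domain `D₂`"
  (loop representation, `z(ℓ) ≤ t^m e^{-Δ|ℓ|}`, the loop integral bound). [Ueltschi1999]
* O. Bratteli, D. W. Robinson, *Operator Algebras and QSM II*, §5.2.2 (CAR matrices). [BratteliRobinsonII1997]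
-/

noncomputable section

namespace Literature.MathematicalPhysics.QuantumLattice

open Matrix Finset NormedSpace Filter HubbardWave0 Literature.Analysis.Complex.FiniteDifference Literature.Probability.LatticeModels
open scoped BigOperators Matrix.Norms.L2Operator Topology

section MatrixComparison

variable {ι : Type*} [Fintype ι] [DecidableEq ι]

/-! ### Entrywise domination of powers and exponentials -/

/-- Entrywise domination is inherited by powers: if `|X_{ij}| ≤ Y_{ij}` for all `i, j`, then
`|(X^k)_{ij}| ≤ (Y^k)_{ij}`. [folklore] -/
theorem norm_pow_apply_le_pow_apply {X : Matrix ι ι ℂ} {Y : Matrix ι ι ℝ}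
    (h : ∀ i j, ‖X i j‖ ≤ Y i j) : ∀ (k : ℕ) (i j : ι), ‖(X ^ k) i j‖ ≤ (Y ^ k) i j
  | 0, i, j => by
      rw [pow_zero, pow_zero, Matrix.one_apply, Matrix.one_apply]
      split_ifs <;> simp
  | k + 1, i, j => by
      rw [pow_succ, pow_succ, Matrix.mul_apply, Matrix.mul_apply]
      refine (norm_sum_le _ _).trans (Finset.sum_le_sum fun l _ => ?_)
      rw [norm_mul]
      have h1 := norm_pow_apply_le_pow_apply h k i l
      exact mul_le_mul h1 (h l j) (norm_nonneg _) ((norm_nonneg _).trans h1)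

/-- Powers of an entrywise nonnegative real matrix are entrywise nonnegative. [folklore] -/
theorem pow_apply_nonneg_of_nonneg {Y : Matrix ι ι ℝ} (h : ∀ i j, 0 ≤ Y i j) :
    ∀ (k : ℕ) (i j : ι), 0 ≤ (Y ^ k) i j
  | 0, i, j => by
      rw [pow_zero, Matrix.one_apply]
      split_ifs <;> norm_num
  | k + 1, i, j => by
      rw [pow_succ, Matrix.mul_apply]
      exact Finset.sum_nonneg fun l _ => mul_nonneg (pow_apply_nonneg_of_nonneg h k i l) (h l j)

/-- The entries of the matrix exponential as a power series (complex matrices). [folklore] -/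
theorem hasSum_exp_apply (X : Matrix ι ι ℂ) (i j : ι) :
    HasSum (fun k : ℕ => ((k.factorial : ℂ)⁻¹ • X ^ k) i j) ((NormedSpace.exp X) i j) :=
  (exp_series_hasSum_exp' (𝕂 := ℂ) X).map (Matrix.entryAddMonoidHom ℂ i j) (continuous_id.matrix_elem i j)

/-- The entries of the matrix exponential as a power series (real matrices). [folklore] -/
theorem hasSum_exp_apply_real (Y : Matrix ι ι ℝ) (i j : ι) :
    HasSum (fun k : ℕ => ((k.factorial : ℝ)⁻¹ • Y ^ k) i j) ((NormedSpace.exp Y) i j) :=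
  (exp_series_hasSum_exp' (𝕂 := ℝ) Y).map (Matrix.entryAddMonoidHom ℝ i j) (continuous_id.matrix_elem i j)

/-- **Entrywise domination of the exponential**: if `|X_{ij}| ≤ Y_{ij}` for all `i, j` (so `Y`
is entrywise nonnegative), then `|(e^X)_{ij}| ≤ (e^Y)_{ij}`. [folklore] -/
theorem norm_exp_apply_le_exp_apply {X : Matrix ι ι ℂ} {Y : Matrix ι ι ℝ}
    (h : ∀ i j, ‖X i j‖ ≤ Y i j) (i j : ι) : ‖(NormedSpace.exp X) i j‖ ≤ (NormedSpace.exp Y) i j := by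
  refine (hasSum_exp_apply X i j).norm_le_of_bounded (hasSum_exp_apply_real Y i j) fun k => ?_
  rw [Matrix.smul_apply, Matrix.smul_apply, norm_smul, norm_inv, Complex.norm_natCast, smul_eq_mul]
  exact mul_le_mul_of_nonneg_left (norm_pow_apply_le_pow_apply h k i j) (inv_nonneg.2 (Nat.cast_nonneg _))

/-- The exponential of an entrywise nonnegative real matrix is entrywise nonnegative. [folklore] -/
theorem exp_apply_nonneg_of_nonneg {Y : Matrix ι ι ℝ} (h : ∀ i j, 0 ≤ Y i j) (i j : ι) :
    0 ≤ (NormedSpace.exp Y) i j :=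
  (hasSum_exp_apply_real Y i j).nonneg fun k => by
    rw [Matrix.smul_apply, smul_eq_mul]
    exact mul_nonneg (inv_nonneg.2 (Nat.cast_nonneg _)) (pow_apply_nonneg_of_nonneg h k i j)

/-! ### Scalar shifts of the exponent -/

/-- `e^{X + s·1} = e^s · e^X` for complex matrices. [folklore] -/
theorem exp_add_smul_one (X : Matrix ι ι ℂ) (s : ℂ) :
    NormedSpace.exp (X + s • (1 : Matrix ι ι ℂ)) = Complex.exp s • NormedSpace.exp X := by
  have hc : Commute X (s • (1 : Matrix ι ι ℂ)) := (Commute.one_right X).smul_right s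
  rw [Matrix.exp_add_of_commute _ _ hc, ← Algebra.algebraMap_eq_smul_one, ← algebraMap_exp_comm s,
    ← Complex.exp_eq_exp_ℂ, Algebra.algebraMap_eq_smul_one, mul_smul_comm, mul_one]

/-- `e^{Y + s·1} = e^s · e^Y` for real matrices. [folklore] -/
theorem exp_add_smul_one_real (Y : Matrix ι ι ℝ) (s : ℝ) :
    NormedSpace.exp (Y + s • (1 : Matrix ι ι ℝ)) = Real.exp s • NormedSpace.exp Y := by
  have hc : Commute Y (s • (1 : Matrix ι ι ℝ)) := (Commute.one_right Y).smul_right s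
  rw [Matrix.exp_add_of_commute _ _ hc, ← Algebra.algebraMap_eq_smul_one, ← algebraMap_exp_comm s,
    ← Real.exp_eq_exp_ℝ, Algebra.algebraMap_eq_smul_one, mul_smul_comm, mul_one]

/-- An elementary estimate: for `ε > 0` and `s ≥ im(z)²/(2ε) - re(z)` one has
`|z + s| ≤ re(z) + s + ε`. [folklore] -/
theorem norm_add_real_le_re_add {z : ℂ} {ε s : ℝ} (hε : 0 < ε) (hs : z.im ^ 2 / (2 * ε) - z.re ≤ s) :
    ‖z + s‖ ≤ z.re + s + ε := by
  have h0 : 0 ≤ z.im ^ 2 / (2 * ε) := by positivity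
  have hre : 0 ≤ z.re + s := by linarith
  have hkey : z.im ^ 2 ≤ 2 * ε * (z.re + s) := by
    have := (div_le_iff₀ (by positivity : (0 : ℝ) < 2 * ε)).1 (show z.im ^ 2 / (2 * ε) ≤ z.re + s by linarith)
    linarith
  rw [Complex.norm_eq_sqrt_sq_add_sq, Real.sqrt_le_iff]
  refine ⟨by linarith, ?_⟩
  simp only [Complex.add_re, Complex.ofReal_re, Complex.add_im, Complex.ofReal_im, add_zero]
  nlinarith [sq_nonneg ε]

/-- **Entrywise domination of the exponential, diagonal compared through real parts**: if
`|X_{ij}| ≤ Y_{ij}` for `i ≠ j` and `re X_{ii} ≤ Y_{ii}`, then `|(e^X)_{ij}| ≤ (e^Y)_{ij}`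
(apply the previous bound to `X + s·1`, `Y + (s+ε)·1` for large `s` and let `ε → 0`). [folklore] -/
theorem norm_exp_apply_le_exp_apply_of_re_le {X : Matrix ι ι ℂ} {Y : Matrix ι ι ℝ}
    (hoff : ∀ i j, i ≠ j → ‖X i j‖ ≤ Y i j) (hdiag : ∀ i, (X i i).re ≤ Y i i) (i j : ι) :
    ‖(NormedSpace.exp X) i j‖ ≤ (NormedSpace.exp Y) i j := by
  -- for every `ε > 0`, `‖e^X i j‖ ≤ e^ε (e^Y) i j`
  have hε : ∀ ε : ℝ, 0 < ε → ‖(NormedSpace.exp X) i j‖ ≤ Real.exp ε * (NormedSpace.exp Y) i j := by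
    intro ε hε
    set s : ℝ := ∑ l, ((X l l).im ^ 2 / (2 * ε) + ‖X l l‖) with hs
    have hsl : ∀ l, (X l l).im ^ 2 / (2 * ε) - (X l l).re ≤ s := by
      intro l
      have h1 : (X l l).im ^ 2 / (2 * ε) + ‖X l l‖ ≤ s :=
        Finset.single_le_sum (f := fun l => (X l l).im ^ 2 / (2 * ε) + ‖X l l‖)
          (fun l _ => by positivity) (Finset.mem_univ l)
      have h2 : -(X l l).re ≤ ‖X l l‖ := (neg_le_abs _).trans (Complex.abs_re_le_norm _)
      linarith
    set X' : Matrix ι ι ℂ := X + (s : ℂ) • (1 : Matrix ι ι ℂ) with hX'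
    set Y' : Matrix ι ι ℝ := Y + (s + ε) • (1 : Matrix ι ι ℝ) with hY'
    have hdom : ∀ a b, ‖X' a b‖ ≤ Y' a b := by
      intro a b
      simp only [hX', hY', Matrix.add_apply, Matrix.smul_apply, Matrix.one_apply, smul_eq_mul]
      by_cases hab : a = b
      · subst hab
        simp only [if_true, mul_one]
        calc ‖X a a + (s : ℂ)‖ ≤ (X a a).re + s + ε := norm_add_real_le_re_add hε (hsl a)
          _ ≤ Y a a + (s + ε) := by linarith [hdiag a]
      · simp only [if_neg hab, mul_zero, add_zero]
        exact hoff a b hab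
    have h := norm_exp_apply_le_exp_apply hdom i j
    rw [hX', hY', exp_add_smul_one, exp_add_smul_one_real, Matrix.smul_apply, Matrix.smul_apply, norm_smul,
      Complex.norm_exp, Complex.ofReal_re, smul_eq_mul, Real.exp_add] at h
    have hs0 : 0 < Real.exp s := Real.exp_pos s
    have h' : Real.exp s * ‖(NormedSpace.exp X) i j‖ ≤ Real.exp s * (Real.exp ε * (NormedSpace.exp Y) i j) := by
      calc Real.exp s * ‖(NormedSpace.exp X) i j‖ ≤ Real.exp s * Real.exp ε * (NormedSpace.exp Y) i j := h
        _ = Real.exp s * (Real.exp ε * (NormedSpace.exp Y) i j) := by ring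
    exact le_of_mul_le_mul_left h' hs0
  -- let `ε → 0`
  have hlim : Tendsto (fun ε : ℝ => Real.exp ε * (NormedSpace.exp Y) i j) (𝓝[>] 0) (𝓝 ((NormedSpace.exp Y) i j)) := by
    have h1 : Tendsto (fun ε : ℝ => Real.exp ε * (NormedSpace.exp Y) i j) (𝓝 0) (𝓝 (Real.exp 0 * (NormedSpace.exp Y) i j)) :=
      (Real.continuous_exp.tendsto 0).mul_const _
    rw [Real.exp_zero, one_mul] at h1
    exact h1.mono_left nhdsWithin_le_nhds
  refine ge_of_tendsto hlim ?_
  filter_upwards [self_mem_nhdsWithin] with ε hε' using hε ε hε'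

/-! ### Metzler matrices: sub-invariant vectors bound the diagonal of the exponential -/

omit [DecidableEq ι] in
/-- Monotonicity of `mulVec` for entrywise nonnegative matrices. [folklore] -/
theorem mulVec_le_mulVec_of_nonneg {P : Matrix ι ι ℝ} (hP : ∀ i j, 0 ≤ P i j) {u u' : ι → ℝ}
    (h : ∀ i, u i ≤ u' i) (i : ι) : (P.mulVec u) i ≤ (P.mulVec u') i := by
  simp only [Matrix.mulVec, dotProduct]
  exact Finset.sum_le_sum fun j _ => mul_le_mul_of_nonneg_left (h j) (hP i j)

/-- For an entrywise nonnegative matrix `P` and a vector `v` with `P v ≤ κ v` (`κ ≥ 0`):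
`P^k v ≤ κ^k v`. [folklore] -/
theorem pow_mulVec_le_of_mulVec_le {P : Matrix ι ι ℝ} (hP : ∀ i j, 0 ≤ P i j) {v : ι → ℝ} {κ : ℝ}
    (hκ : 0 ≤ κ) (h : ∀ i, (P.mulVec v) i ≤ κ * v i) : ∀ (k : ℕ) (i : ι), ((P ^ k).mulVec v) i ≤ κ ^ k * v i
  | 0, i => by simp
  | k + 1, i => by
      rw [pow_succ', ← Matrix.mulVec_mulVec]
      calc (P.mulVec ((P ^ k).mulVec v)) i ≤ (P.mulVec (fun j => κ ^ k * v j)) i :=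
            mulVec_le_mulVec_of_nonneg hP (pow_mulVec_le_of_mulVec_le hP hκ h k) i
        _ = κ ^ k * (P.mulVec v) i := by
            simp only [Matrix.mulVec, dotProduct, Finset.mul_sum]
            exact Finset.sum_congr rfl fun j _ => by ring
        _ ≤ κ ^ k * (κ * v i) := mul_le_mul_of_nonneg_left (h i) (pow_nonneg hκ k)
        _ = κ ^ (k + 1) * v i := by ring

omit [DecidableEq ι] in
/-- `M ↦ (M v)_i` is continuous. [folklore] -/
theorem continuous_mulVec_apply (v : ι → ℝ) (i : ι) : Continuous fun M : Matrix ι ι ℝ => (M.mulVec v) i := by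
  simp only [Matrix.mulVec, dotProduct]
  exact continuous_finsetSum _ fun j _ => (continuous_id.matrix_elem i j).mul continuous_const

/-- The additive map `M ↦ (M v)_i`. [folklore] -/
def mulVecApplyHom (v : ι → ℝ) (i : ι) : Matrix ι ι ℝ →+ ℝ where
  toFun M := (M.mulVec v) i
  map_zero' := by simp
  map_add' M N := by simp [Matrix.add_mulVec]

/-- For an entrywise nonnegative matrix `P` and a vector `v` with `P v ≤ κ v`, `κ ≥ 0`:
`(e^P v)_i ≤ e^κ v_i` (term by term in the exponential series). [folklore] -/
theorem exp_mulVec_le_of_mulVec_le {P : Matrix ι ι ℝ} (hP : ∀ i j, 0 ≤ P i j) {v : ι → ℝ} {κ : ℝ}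
    (hκ : 0 ≤ κ) (h : ∀ i, (P.mulVec v) i ≤ κ * v i) (i : ι) :
    ((NormedSpace.exp P).mulVec v) i ≤ Real.exp κ * v i := by
  have h1 : HasSum (fun k : ℕ => (((k.factorial : ℝ)⁻¹ • P ^ k).mulVec v) i) (((NormedSpace.exp P).mulVec v) i) :=
    (exp_series_hasSum_exp' (𝕂 := ℝ) P).map (mulVecApplyHom v i) (continuous_mulVec_apply v i)
  have h2 : HasSum (fun k : ℕ => (k.factorial : ℝ)⁻¹ * κ ^ k * v i) (Real.exp κ * v i) := by
    have h := (exp_series_hasSum_exp' (𝕂 := ℝ) κ).mul_right (v i)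
    rw [← Real.exp_eq_exp_ℝ] at h
    simpa [smul_eq_mul] using h
  refine hasSum_le (fun k => ?_) h1 h2
  rw [Matrix.smul_mulVec, Pi.smul_apply, smul_eq_mul, mul_assoc]
  exact mul_le_mul_of_nonneg_left (pow_mulVec_le_of_mulVec_le hP hκ h k i) (inv_nonneg.2 (Nat.cast_nonneg _))

/-- **Sub-invariant vectors of Metzler matrices.** Let `G` be a real matrix with nonnegative
off-diagonal entries, `v` an entrywise positive vector and `κ` a real number with `G v ≤ κ v`
entrywise. Then every diagonal entry of `e^G` is at most `e^κ`. [folklore] -/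
theorem exp_apply_self_le_of_mulVec_le {G : Matrix ι ι ℝ} (hG : ∀ i j, i ≠ j → 0 ≤ G i j)
    {v : ι → ℝ} (hv : ∀ i, 0 < v i) {κ : ℝ} (h : ∀ i, (G.mulVec v) i ≤ κ * v i) (i : ι) :
    (NormedSpace.exp G) i i ≤ Real.exp κ := by
  -- shift to a nonnegative matrix
  set s : ℝ := ∑ l, |G l l| + |κ| with hs
  have hsl : ∀ l, 0 ≤ G l l + s := by
    intro l
    have h1 : |G l l| ≤ ∑ l, |G l l| := Finset.single_le_sum (f := fun l => |G l l|) (fun l _ => abs_nonneg _) (Finset.mem_univ l)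
    have h2 : -G l l ≤ |G l l| := neg_le_abs _
    have h3 : 0 ≤ |κ| := abs_nonneg κ
    linarith
  have hκs : 0 ≤ κ + s := by
    have h1 : 0 ≤ ∑ l, |G l l| := Finset.sum_nonneg fun l _ => abs_nonneg _
    have h2 : -κ ≤ |κ| := neg_le_abs κ
    linarith
  set P : Matrix ι ι ℝ := G + s • (1 : Matrix ι ι ℝ) with hP
  have hPnn : ∀ a b, 0 ≤ P a b := by
    intro a b
    simp only [hP, Matrix.add_apply, Matrix.smul_apply, Matrix.one_apply, smul_eq_mul]
    by_cases hab : a = b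
    · subst hab; simp only [if_true, mul_one]; exact hsl a
    · simp only [if_neg hab, mul_zero, add_zero]; exact hG a b hab
  have hPv : ∀ a, (P.mulVec v) a ≤ (κ + s) * v a := by
    intro a
    simp only [hP, Matrix.add_mulVec, Pi.add_apply, Matrix.smul_mulVec, Pi.smul_apply, Matrix.one_mulVec,
      smul_eq_mul]
    have := h a
    linarith
  -- the diagonal entry of `e^P`
  have hdiag : (NormedSpace.exp P) i i * v i ≤ Real.exp (κ + s) * v i := by
    calc (NormedSpace.exp P) i i * v i ≤ ((NormedSpace.exp P).mulVec v) i := by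
          simp only [Matrix.mulVec, dotProduct]
          exact Finset.single_le_sum (f := fun j => (NormedSpace.exp P) i j * v j)
            (fun j _ => mul_nonneg (exp_apply_nonneg_of_nonneg hPnn i j) (hv j).le) (Finset.mem_univ i)
      _ ≤ Real.exp (κ + s) * v i := exp_mulVec_le_of_mulVec_le hPnn hκs hPv i
  have hPi : (NormedSpace.exp P) i i ≤ Real.exp (κ + s) := le_of_mul_le_mul_right hdiag (hv i)
  -- back to `G = P - s·1`
  have hG' : G = P + (-s) • (1 : Matrix ι ι ℝ) := by rw [hP, add_assoc, ← add_smul, add_neg_cancel, zero_smul, add_zero]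
  rw [hG', exp_add_smul_one_real, Matrix.smul_apply, smul_eq_mul]
  calc Real.exp (-s) * (NormedSpace.exp P) i i ≤ Real.exp (-s) * Real.exp (κ + s) :=
        mul_le_mul_of_nonneg_left hPi (Real.exp_nonneg _)
    _ = Real.exp κ := by rw [← Real.exp_add]; ring_nf

/-- The exponential of a Metzler matrix is entrywise nonnegative. [folklore] -/
theorem exp_apply_nonneg_of_offdiag_nonneg {G : Matrix ι ι ℝ} (hG : ∀ i j, i ≠ j → 0 ≤ G i j) (i j : ι) :
    0 ≤ (NormedSpace.exp G) i j := by
  set s : ℝ := ∑ l, |G l l| with hs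
  have hsl : ∀ l, 0 ≤ G l l + s := by
    intro l
    have h1 : |G l l| ≤ ∑ l, |G l l| := Finset.single_le_sum (f := fun l => |G l l|) (fun l _ => abs_nonneg _) (Finset.mem_univ l)
    have h2 : -G l l ≤ |G l l| := neg_le_abs _
    linarith
  set P : Matrix ι ι ℝ := G + s • (1 : Matrix ι ι ℝ) with hP
  have hPnn : ∀ a b, 0 ≤ P a b := by
    intro a b
    simp only [hP, Matrix.add_apply, Matrix.smul_apply, Matrix.one_apply, smul_eq_mul]
    by_cases hab : a = b
    · subst hab; simp only [if_true, mul_one]; exact hsl a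
    · simp only [if_neg hab, mul_zero, add_zero]; exact hG a b hab
  have hG' : G = P + (-s) • (1 : Matrix ι ι ℝ) := by rw [hP, add_assoc, ← add_smul, add_neg_cancel, zero_smul, add_zero]
  rw [hG', exp_add_smul_one_real, Matrix.smul_apply, smul_eq_mul]
  exact mul_nonneg (Real.exp_nonneg _) (exp_apply_nonneg_of_nonneg hPnn i j)

/-- **Trace bound by comparison.** If the complex matrix `X` is entrywise dominated by the real
Metzler matrix `Y` (`|X_{ij}| ≤ Y_{ij}` off the diagonal, `re X_{ii} ≤ Y_{ii}`) and `Y v ≤ κ v`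
for an entrywise positive vector `v`, then `|Tr e^X| ≤ |ι| e^κ`. [folklore] -/
theorem norm_trace_exp_le_card_mul_exp {X : Matrix ι ι ℂ} {Y : Matrix ι ι ℝ}
    (hoff : ∀ i j, i ≠ j → ‖X i j‖ ≤ Y i j) (hdiag : ∀ i, (X i i).re ≤ Y i i)
    {v : ι → ℝ} (hv : ∀ i, 0 < v i) {κ : ℝ} (h : ∀ i, (Y.mulVec v) i ≤ κ * v i) :
    ‖(NormedSpace.exp X).trace‖ ≤ Fintype.card ι * Real.exp κ := by
  have hY : ∀ i j, i ≠ j → 0 ≤ Y i j := fun i j hij => (norm_nonneg _).trans (hoff i j hij)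
  calc ‖(NormedSpace.exp X).trace‖ = ‖∑ i, (NormedSpace.exp X) i i‖ := rfl
    _ ≤ ∑ i, ‖(NormedSpace.exp X) i i‖ := norm_sum_le _ _
    _ ≤ ∑ i, (NormedSpace.exp Y) i i := Finset.sum_le_sum fun i _ => norm_exp_apply_le_exp_apply_of_re_le hoff hdiag i i
    _ ≤ ∑ _i : ι, Real.exp κ := Finset.sum_le_sum fun i _ => exp_apply_self_le_of_mulVec_le hY hv h i
    _ = Fintype.card ι * Real.exp κ := by rw [Finset.sum_const, nsmul_eq_mul, Finset.card_univ]


end MatrixComparison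

/-! ### The hopping matrices in the occupation basis -/

section Hops

variable {Λ : Type*} [LinearOrder Λ] [Fintype Λ]

/-- The configuration reached from `s` by undoing the hop `b = (x, y, σ)`: remove `xσ`, add `yσ`.
[folklore] -/
def hopBack (b : Bond Λ) (s : Finset (Orb Λ)) : Finset (Orb Λ) :=
  insert (orb b.2.1 b.2.2) (s.erase (orb b.1 b.2.2))

/-- **Nonzero entries of `T_b = c†_{xσ} c_{yσ}`**: `⟨s| T_b |s'⟩ ≠ 0` forces `xσ ∈ s`,
`yσ ∉ s ∖ {xσ}` and `s' = (s ∖ {xσ}) ∪ {yσ}`. [cite: BratteliRobinsonII1997, §5.2.2] -/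
theorem bondOp_apply_ne_zero {b : Bond Λ} {s s' : Finset (Orb Λ)} (h : bondOp b s s' ≠ 0) :
    orb b.1 b.2.2 ∈ s ∧ orb b.2.1 b.2.2 ∉ s.erase (orb b.1 b.2.2) ∧ s' = hopBack b s := by
  rw [bondOp, Matrix.mul_apply] at h
  obtain ⟨t, -, ht⟩ := Finset.exists_ne_zero_of_sum_ne_zero h
  have h1 : creation (orb b.1 b.2.2) s t ≠ 0 := left_ne_zero_of_mul ht
  have h2 : annihilation (orb b.2.1 b.2.2) t s' ≠ 0 := right_ne_zero_of_mul ht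
  rw [creation_apply] at h1
  rw [annihilation_apply] at h2
  split_ifs at h1 with hc
  · split_ifs at h2 with ha
    · obtain ⟨hxt, rfl⟩ := hc
      obtain ⟨hyt, rfl⟩ := ha
      have ht' : (insert (orb b.1 b.2.2) t).erase (orb b.1 b.2.2) = t := Finset.erase_insert hxt
      refine ⟨Finset.mem_insert_self _ _, ?_, ?_⟩
      · rwa [ht']
      · rw [hopBack, ht']
    · exact absurd rfl h2
  · exact absurd rfl h1

/-- `|⟨s| T_b |s'⟩| ≤ 1`. [folklore] -/
theorem norm_bondOp_apply_le_one (b : Bond Λ) (s s' : Finset (Orb Λ)) : ‖bondOp b s s'‖ ≤ 1 := by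
  rw [bondOp, Matrix.mul_apply]
  have hsum : ∑ t, creation (orb b.1 b.2.2) s t * annihilation (orb b.2.1 b.2.2) t s' =
      creation (orb b.1 b.2.2) s (s.erase (orb b.1 b.2.2)) * annihilation (orb b.2.1 b.2.2) (s.erase (orb b.1 b.2.2)) s' := by
    apply Finset.sum_eq_single
    · intro t _ ht
      rw [creation_apply]
      split_ifs with hc
      · exfalso; apply ht; rw [hc.2, Finset.erase_insert hc.1]
      · rw [zero_mul]
    · intro h; exact absurd (Finset.mem_univ _) h
  rw [hsum, norm_mul]
  have hc : ‖creation (orb b.1 b.2.2) s (s.erase (orb b.1 b.2.2))‖ ≤ 1 := by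
    rw [creation_apply]; split_ifs <;> simp [jwSign]
  have ha : ‖annihilation (orb b.2.1 b.2.2) (s.erase (orb b.1 b.2.2)) s'‖ ≤ 1 := by
    rw [annihilation_apply]; split_ifs <;> simp [jwSign]
  calc _ ≤ 1 * 1 := mul_le_mul hc ha (norm_nonneg _) zero_le_one
    _ = 1 := one_mul 1

/-- **Row sums of `|T_b|`**: for a bond `b = (x, y, σ)` with `x ≠ y` and a nonnegative weight
`w` on configurations, `Σ_{s'} |⟨s|T_b|s'⟩| w(s') ≤ 1(xσ ∈ s, yσ ∉ s) · w(hopBack b s)`.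
[folklore] -/
theorem sum_norm_bondOp_apply_mul_le {b : Bond Λ} (hb : b.1 ≠ b.2.1) (s : Finset (Orb Λ))
    {w : Finset (Orb Λ) → ℝ} (hw : ∀ s', 0 ≤ w s') :
    ∑ s', ‖bondOp b s s'‖ * w s' ≤
      if orb b.1 b.2.2 ∈ s ∧ orb b.2.1 b.2.2 ∉ s then w (hopBack b s) else 0 := by
  have hsum : ∑ s', ‖bondOp b s s'‖ * w s' = ‖bondOp b s (hopBack b s)‖ * w (hopBack b s) := by
    apply Finset.sum_eq_single
    · intro s' _ hs'
      by_cases h0 : bondOp b s s' = 0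
      · rw [h0, norm_zero, zero_mul]
      · exact absurd (bondOp_apply_ne_zero h0).2.2 hs'
    · intro h; exact absurd (Finset.mem_univ _) h
  rw [hsum]
  split_ifs with hcond
  · calc ‖bondOp b s (hopBack b s)‖ * w (hopBack b s) ≤ 1 * w (hopBack b s) :=
          mul_le_mul_of_nonneg_right (norm_bondOp_apply_le_one b s _) (hw _)
      _ = w (hopBack b s) := one_mul _
  · have h0 : bondOp b s (hopBack b s) = 0 := by
      by_contra h0
      obtain ⟨hx, hy, -⟩ := bondOp_apply_ne_zero h0
      refine hcond ⟨hx, fun hys => hy (Finset.mem_erase.2 ⟨?_, hys⟩)⟩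
      intro heq
      exact hb (orb_eq_orb_iff.1 heq).1.symm
    rw [h0, norm_zero, zero_mul]

/-! ### Excited (not singly occupied) sites -/

/-- The site `x` is NOT singly occupied in the configuration `s` (empty or doubly occupied).
[cite: Ueltschi1999, §3 (vertical segments where n_x ∈ {0,2})] -/
def IsExcited (s : Finset (Orb Λ)) (x : Λ) : Prop := (orb x 0 ∈ s ↔ orb x 1 ∈ s)

/-- `IsExcited s x` is decidable (it is an `Iff` of decidable memberships). [folklore] -/
instance instDecidableIsExcited (s : Finset (Orb Λ)) (x : Λ) : Decidable (IsExcited s x) :=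
  inferInstanceAs (Decidable (_ ↔ _))

/-- The number of sites of `A` that are empty or doubly occupied in `s`. [cite: Ueltschi1999, §3] -/
def excCount (A : Finset Λ) (s : Finset (Orb Λ)) : ℕ := (A.filter fun x => IsExcited s x).card

omit [Fintype Λ] in
/-- `excCount` as a sum of indicators. [folklore] -/
theorem excCount_eq_sum (A : Finset Λ) (s : Finset (Orb Λ)) :
    excCount A s = ∑ x ∈ A, if IsExcited s x then 1 else 0 := by
  rw [excCount, Finset.card_filter]

omit [Fintype Λ] in
/-- `excCount ≤ |A|`. [folklore] -/
theorem excCount_le_card (A : Finset Λ) (s : Finset (Orb Λ)) : excCount A s ≤ A.card :=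
  Finset.card_filter_le _ _

omit [LinearOrder Λ] [Fintype Λ] in
/-- Removing the occupied orbital `xσ` (the other orbital of `x` untouched) toggles the excitation
of `x`. [folklore] -/
theorem isExcited_toggle_of_remove {s s₁ : Finset (Orb Λ)} {x : Λ} {σ : Fin 2} (hin : orb x σ ∈ s)
    (hout : orb x σ ∉ s₁) (hother : ∀ τ, τ ≠ σ → (orb x τ ∈ s₁ ↔ orb x τ ∈ s)) :
    IsExcited s₁ x ↔ ¬ IsExcited s x := by
  unfold IsExcited
  fin_cases σ
  · have h1 := hother 1 (by decide)
    simp only [Fin.zero_eta] at hin hout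
    simp only [hout, false_iff, h1, hin, true_iff]
  · have h0 := hother 0 (by decide)
    simp only [Fin.mk_one] at hin hout
    simp only [hout, iff_false, h0, hin, iff_true]

omit [LinearOrder Λ] [Fintype Λ] in
/-- Adding the unoccupied orbital `yσ` (the other orbital of `y` untouched) toggles the excitation
of `y`. [folklore] -/
theorem isExcited_toggle_of_add {s s₁ : Finset (Orb Λ)} {y : Λ} {σ : Fin 2} (hnot : orb y σ ∉ s)
    (hin : orb y σ ∈ s₁) (hother : ∀ τ, τ ≠ σ → (orb y τ ∈ s₁ ↔ orb y τ ∈ s)) :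
    IsExcited s₁ y ↔ ¬ IsExcited s y := by
  unfold IsExcited
  fin_cases σ
  · have h1 := hother 1 (by decide)
    simp only [Fin.zero_eta] at hin hnot
    simp only [hin, true_iff, h1, hnot, false_iff, not_not]
  · have h0 := hother 0 (by decide)
    simp only [Fin.mk_one] at hin hnot
    simp only [hin, iff_true, h0, hnot, iff_false, not_not]

omit [Fintype Λ] in
/-- **A hop toggles the excitation of both its endpoints**: for `b = (x, y, σ)`, `x ≠ y`, with
`xσ ∈ s`, `yσ ∉ s` and `s₁ = hopBack b s`,
`excCount A s₁ + 2·1(x excited in s) + 2·1(y excited in s) = excCount A s + 2` (`x, y ∈ A`).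
[cite: Ueltschi1999, §3 (the loops alternate jumps and vertical segments)] -/
theorem excCount_hopBack {A : Finset Λ} {x y : Λ} {σ : Fin 2} (hb : x ≠ y) (hx : x ∈ A) (hy : y ∈ A)
    {s : Finset (Orb Λ)} (hxs : orb x σ ∈ s) (hys : orb y σ ∉ s) :
    excCount A (hopBack (x, y, σ) s) + 2 * (if IsExcited s x then 1 else 0) + 2 * (if IsExcited s y then 1 else 0) =
      excCount A s + 2 := by
  set s₁ := hopBack (x, y, σ) s with hs₁
  -- membership in `s₁`
  have hmem : ∀ o : Orb Λ, o ∈ s₁ ↔ o = orb y σ ∨ (o ∈ s ∧ o ≠ orb x σ) := by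
    intro o
    rw [hs₁, hopBack, Finset.mem_insert, Finset.mem_erase]
    tauto
  have hxy : orb x σ ≠ orb y σ := fun h => hb (orb_eq_orb_iff.1 h).1
  -- sites other than `x`, `y`
  have hother : ∀ z, z ≠ x → z ≠ y → (IsExcited s₁ z ↔ IsExcited s z) := by
    intro z hzx hzy
    have hτ : ∀ τ : Fin 2, (orb z τ ∈ s₁ ↔ orb z τ ∈ s) := by
      intro τ
      rw [hmem]
      constructor
      · rintro (h | h)
        · exact absurd (orb_eq_orb_iff.1 h).1 hzy
        · exact h.1
      · intro h; exact Or.inr ⟨h, fun h' => hzx (orb_eq_orb_iff.1 h').1⟩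
    unfold IsExcited
    rw [hτ 0, hτ 1]
  -- at `x` and at `y`: toggled
  have hxtog : IsExcited s₁ x ↔ ¬ IsExcited s x := by
    refine isExcited_toggle_of_remove hxs ?_ fun τ hτ => ?_
    · rw [hmem]; rintro (h | h)
      · exact hxy h
      · exact h.2 rfl
    · rw [hmem]
      constructor
      · rintro (h | h)
        · exact absurd (orb_eq_orb_iff.1 h).1 hb
        · exact h.1
      · intro h
        exact Or.inr ⟨h, fun h' => hτ (orb_eq_orb_iff.1 h').2⟩
  have hytog : IsExcited s₁ y ↔ ¬ IsExcited s y := by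
    refine isExcited_toggle_of_add hys ?_ fun τ hτ => ?_
    · rw [hmem]; exact Or.inl rfl
    · rw [hmem]
      constructor
      · rintro (h | h)
        · exact absurd (orb_eq_orb_iff.1 h).2 hτ
        · exact h.1
      · intro h
        exact Or.inr ⟨h, fun h' => hb (orb_eq_orb_iff.1 h').1.symm⟩
  -- split the sums
  have hyA' : y ∈ A.erase x := Finset.mem_erase.2 ⟨fun h => hb h.symm, hy⟩
  have hsplit : ∀ f : Λ → ℕ, ∑ z ∈ A, f z = f x + f y + ∑ z ∈ (A.erase x).erase y, f z := by
    intro f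
    rw [← Finset.add_sum_erase A f hx, ← Finset.add_sum_erase (A.erase x) f hyA', add_assoc]
  have hrest : ∑ z ∈ (A.erase x).erase y, (if IsExcited s₁ z then 1 else 0) =
      ∑ z ∈ (A.erase x).erase y, (if IsExcited s z then 1 else 0) := by
    refine Finset.sum_congr rfl fun z hz => ?_
    have hzy : z ≠ y := Finset.ne_of_mem_erase hz
    have hzx : z ≠ x := Finset.ne_of_mem_erase (Finset.mem_of_mem_erase hz)
    by_cases h : IsExcited s z
    · rw [if_pos h, if_pos ((hother z hzx hzy).2 h)]
    · rw [if_neg h, if_neg (mt (hother z hzx hzy).1 h)]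
  rw [excCount_eq_sum, excCount_eq_sum, hsplit, hsplit, hrest]
  by_cases hX : IsExcited s x <;> by_cases hY : IsExcited s y
  · rw [if_pos hX, if_pos hY, if_neg (fun h => (hxtog.1 h) hX), if_neg (fun h => (hytog.1 h) hY)]; omega
  · rw [if_pos hX, if_neg hY, if_neg (fun h => (hxtog.1 h) hX), if_pos (hytog.2 hY)]
  · rw [if_neg hX, if_pos hY, if_pos (hxtog.2 hX), if_neg (fun h => (hytog.1 h) hY)]
  · rw [if_neg hX, if_neg hY, if_pos (hxtog.2 hX), if_pos (hytog.2 hY)]; omega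

omit [Fintype Λ] in
/-- Corollary: any such hop changes `excCount` by at most `2` downwards. [folklore] -/
theorem excCount_le_excCount_hopBack_add {A : Finset Λ} {b : Bond Λ} (hb : b.1 ≠ b.2.1) (hx : b.1 ∈ A)
    (hy : b.2.1 ∈ A) {s : Finset (Orb Λ)} (hxs : orb b.1 b.2.2 ∈ s) (hys : orb b.2.1 b.2.2 ∉ s) :
    excCount A s ≤ excCount A (hopBack b s) + 2 := by
  have h := excCount_hopBack (A := A) hb hx hy hxs hys
  have e : hopBack (b.1, b.2.1, b.2.2) s = hopBack b s := rfl
  rw [e] at h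
  have h1 : (if IsExcited s b.1 then 1 else 0) ≤ 1 := by split_ifs <;> norm_num
  have h2 : (if IsExcited s b.2.1 then 1 else 0) ≤ 1 := by split_ifs <;> norm_num
  omega

omit [Fintype Λ] in
/-- Corollary: a hop between two singly occupied sites creates two excitations. [folklore] -/
theorem excCount_hopBack_of_not_isExcited {A : Finset Λ} {b : Bond Λ} (hb : b.1 ≠ b.2.1) (hx : b.1 ∈ A)
    (hy : b.2.1 ∈ A) {s : Finset (Orb Λ)} (hxs : orb b.1 b.2.2 ∈ s) (hys : orb b.2.1 b.2.2 ∉ s)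
    (hX : ¬ IsExcited s b.1) (hY : ¬ IsExcited s b.2.1) :
    excCount A (hopBack b s) = excCount A s + 2 := by
  have h := excCount_hopBack (A := A) hb hx hy hxs hys
  have e : hopBack (b.1, b.2.1, b.2.2) s = hopBack b s := rfl
  rw [e] at h
  rw [if_neg hX, if_neg hY] at h
  omega

/-! ### The on-site energies: real parts and the gap -/

omit [Fintype Λ] in
/-- **The gap**: with `a = re(βμ)`, `u = re(βU)` and `δ = min(a, u - a)`, the real part of
`-β v_x(s)` is at most `a - δ · 1(x excited)` (empty: `0`; singly occupied: `a`; doubly occupied: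
`2a - u`). [cite: Ueltschi1999, §3 (z(ℓ) ≤ t^m e^{-Δ|ℓ|}, Δ = min(μ, U-μ))] -/
theorem re_neg_mul_onSiteEnergyAt_le (β U μ : ℂ) (x : Λ) (s : Finset (Orb Λ)) :
    (-(β * onSiteEnergyAt U μ x s)).re ≤
      (β * μ).re - min (β * μ).re ((β * U).re - (β * μ).re) * (if IsExcited s x then 1 else 0) := by
  have hmin1 : min (β * μ).re ((β * U).re - (β * μ).re) ≤ (β * μ).re := min_le_left _ _
  have hmin2 : min (β * μ).re ((β * U).re - (β * μ).re) ≤ (β * U).re - (β * μ).re := min_le_right _ _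
  by_cases h0 : orb x 0 ∈ s <;> by_cases h1 : orb x 1 ∈ s
  · have e : -(β * onSiteEnergyAt U μ x s) = (β * μ + β * μ) - β * U := by
      rw [onSiteEnergyAt, if_pos ⟨h0, h1⟩, if_pos h0, if_pos h1]; ring
    rw [e, if_pos (show IsExcited s x from iff_of_true h0 h1), Complex.sub_re, Complex.add_re]
    linarith
  · have e : -(β * onSiteEnergyAt U μ x s) = β * μ := by
      rw [onSiteEnergyAt, if_neg (fun h => h1 h.2), if_pos h0, if_neg h1]; ring
    rw [e, if_neg (show ¬ IsExcited s x from fun h => h1 (h.1 h0))]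
    linarith
  · have e : -(β * onSiteEnergyAt U μ x s) = β * μ := by
      rw [onSiteEnergyAt, if_neg (fun h => h0 h.1), if_neg h0, if_pos h1]; ring
    rw [e, if_neg (show ¬ IsExcited s x from fun h => h0 (h.2 h1))]
    linarith
  · have e : -(β * onSiteEnergyAt U μ x s) = 0 := by
      rw [onSiteEnergyAt, if_neg (fun h => h0 h.1), if_neg h0, if_neg h1]; ring
    rw [e, if_pos (show IsExcited s x from iff_of_false h0 h1), Complex.zero_re]
    linarith

omit [Fintype Λ] in
/-- The diagonal of `-βV_A` has real part at most `a|A| - δ · excCount A s`. [cite: Ueltschi1999, §3] -/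
theorem re_neg_mul_sum_onSiteEnergyAt_le (β U μ : ℂ) (A : Finset Λ) (s : Finset (Orb Λ)) :
    (-(β * ∑ x ∈ A, onSiteEnergyAt U μ x s)).re ≤
      (β * μ).re * A.card - min (β * μ).re ((β * U).re - (β * μ).re) * excCount A s := by
  rw [Finset.mul_sum, ← Finset.sum_neg_distrib, Complex.re_sum, excCount_eq_sum, Nat.cast_sum, Finset.mul_sum]
  calc ∑ x ∈ A, (-(β * onSiteEnergyAt U μ x s)).re
      ≤ ∑ x ∈ A, ((β * μ).re - min (β * μ).re ((β * U).re - (β * μ).re) * (if IsExcited s x then 1 else 0)) :=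
        Finset.sum_le_sum fun x _ => re_neg_mul_onSiteEnergyAt_le β U μ x s
    _ = (β * μ).re * A.card - ∑ x ∈ A, min (β * μ).re ((β * U).re - (β * μ).re) * ((if IsExcited s x then 1 else 0 : ℕ) : ℝ) := by
        rw [Finset.sum_sub_distrib, Finset.sum_const, nsmul_eq_mul, mul_comm]
        congr 1
        refine Finset.sum_congr rfl fun x _ => ?_
        split_ifs <;> simp

/-- The one-site real partition function dominates `2 e^{a}`: `z₀(1, u, a) ≥ 2e^{a}`. [folklore] -/
theorem two_mul_exp_le_atomicPartitionFnReal (u a : ℝ) : 2 * Real.exp a ≤ atomicPartitionFnReal 1 u a := by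
  unfold atomicPartitionFnReal
  have h1 : 0 ≤ Real.exp (-(1 * (u - 2 * a))) := Real.exp_nonneg _
  rw [one_mul]
  linarith

end Hops

/-! ### The comparison (Lyapunov) estimate and the gap bound on the normalised Gibbs factor -/

section GapBound

variable {Λ : Type*} [LinearOrder Λ] [Fintype Λ]

/-- The real comparison matrix of `-βV_A + Σ_b c_b T_b` for couplings `|c_b| ≤ g` supported in
`K`: diagonal `re(-β v_A(s))`, off-diagonal `g Σ_{b ∈ K} |⟨s|T_b|s'⟩|`. [folklore] -/
def gapCompMatrix (β U μ : ℂ) (A : Finset Λ) (K : Finset (Bond Λ)) (g : ℝ) :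
    Matrix (Finset (Orb Λ)) (Finset (Orb Λ)) ℝ :=
  Matrix.diagonal (fun s => (-(β * ∑ x ∈ A, onSiteEnergyAt U μ x s)).re) +
    g • Matrix.of fun s s' => ∑ b ∈ K, ‖bondOp b s s'‖

/-- The Lyapunov vector `v(s) = η^{⌈excCount A s / 2⌉}`. [folklore] -/
def gapWeight (A : Finset Λ) (η : ℝ) (s : Finset (Orb Λ)) : ℝ := η ^ ((excCount A s + 1) / 2)

omit [Fintype Λ] in
/-- The Lyapunov vector is positive for `η > 0`. [folklore] -/
theorem gapWeight_pos (A : Finset Λ) {η : ℝ} (hη : 0 < η) (s : Finset (Orb Λ)) : 0 < gapWeight A η s :=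
  pow_pos hη _

/-- **The Lyapunov inequality.** Let the bonds of `K` join distinct sites of `A`, at most `M` of
them at any site, `0 ≤ g`, `0 < η ≤ 1` and `g M ≤ δ η` with `δ = min(re βμ, re βU - re βμ)`.
Then `Y v ≤ (a|A| + g|K|η) v` for the comparison matrix `Y` and `v(s) = η^{⌈exc(s)/2⌉}`: a hop
out of the singly-occupied sector costs a factor `η` (at most `|K|` such hops), a hop at an
excited site gains at most `η⁻¹` but there are at most `M · exc(s)` of them, paid by the gap
`δ · exc(s)`. [cite: Ueltschi1999, §3 (proof of Theorem 3.1 on D₂: each jump is followed by a vertical segment of an excited site, ∫ e^{-Δτ} dτ = 1/Δ)] -/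
theorem gapCompMatrix_mulVec_le (β U μ : ℂ) {A : Finset Λ} {K : Finset (Bond Λ)}
    (hKA : ∀ b ∈ K, b.1 ∈ A ∧ b.2.1 ∈ A) (hKne : ∀ b ∈ K, b.1 ≠ b.2.1) {M : ℕ}
    (hM : ∀ x, (K.filter fun b => x ∈ Bond.verts b).card ≤ M) {g η : ℝ} (hg : 0 ≤ g) (hη0 : 0 < η) (hη1 : η ≤ 1)
    (hgap : g * M ≤ min (β * μ).re ((β * U).re - (β * μ).re) * η) (s : Finset (Orb Λ)) :
    ((gapCompMatrix β U μ A K g).mulVec (gapWeight A η)) s ≤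
      ((β * μ).re * A.card + g * K.card * η) * gapWeight A η s := by
  classical
  set δ : ℝ := min (β * μ).re ((β * U).re - (β * μ).re) with hδ
  set a : ℝ := (β * μ).re with ha
  set k : ℕ := excCount A s with hk
  set d : ℕ := (k + 1) / 2 with hd
  have hv : gapWeight A η s = η ^ d := rfl
  have hw0 : ∀ s', 0 ≤ gapWeight A η s' := fun s' => (gapWeight_pos A hη0 s').le
  -- unfold the matrix-vector product
  have hmul : ((gapCompMatrix β U μ A K g).mulVec (gapWeight A η)) s =
      (-(β * ∑ x ∈ A, onSiteEnergyAt U μ x s)).re * gapWeight A η s +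
        g * ∑ b ∈ K, ∑ s', ‖bondOp b s s'‖ * gapWeight A η s' := by
    rw [gapCompMatrix, Matrix.add_mulVec, Pi.add_apply, Matrix.mulVec_diagonal, Matrix.smul_mulVec, Pi.smul_apply,
      smul_eq_mul]
    congr 2
    simp only [Matrix.mulVec, dotProduct, Matrix.of_apply, Finset.sum_mul]
    rw [Finset.sum_comm]
  -- the hopping part, bond by bond
  set K₁ := K.filter fun b => ¬ IsExcited s b.1 ∧ ¬ IsExcited s b.2.1 with hK₁
  set K₂ := K.filter fun b => IsExcited s b.1 ∨ IsExcited s b.2.1 with hK₂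
  have hKsplit : ∀ f : Bond Λ → ℝ, ∑ b ∈ K, f b = ∑ b ∈ K₁, f b + ∑ b ∈ K₂, f b := by
    intro f
    have hK₂' : K₂ = K.filter fun b => ¬ (¬ IsExcited s b.1 ∧ ¬ IsExcited s b.2.1) := by
      rw [hK₂]; congr 1; funext b; simp only [not_and_or, not_not]
    rw [hK₂', hK₁]
    exact (Finset.sum_filter_add_sum_filter_not K _ f).symm
  have hbond : ∀ b ∈ K, ∑ s', ‖bondOp b s s'‖ * gapWeight A η s' ≤
      if orb b.1 b.2.2 ∈ s ∧ orb b.2.1 b.2.2 ∉ s then gapWeight A η (hopBack b s) else 0 :=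
    fun b hb => sum_norm_bondOp_apply_mul_le (hKne b hb) s hw0
  -- bonds between singly occupied sites: a factor `η^{d+1}`
  have h₁ : ∀ b ∈ K₁, ∑ s', ‖bondOp b s s'‖ * gapWeight A η s' ≤ η ^ (d + 1) := by
    intro b hb
    obtain ⟨hbK, hX, hY⟩ := Finset.mem_filter.1 hb
    refine (hbond b hbK).trans ?_
    split_ifs with hcond
    · rw [gapWeight, excCount_hopBack_of_not_isExcited (hKne b hbK) (hKA b hbK).1 (hKA b hbK).2 hcond.1 hcond.2 hX hY]
      apply le_of_eq
      congr 1
      rw [hd, hk]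
      omega
    · positivity
  -- bonds at an excited site: a factor at most `η^{d-1}`
  have h₂ : ∀ b ∈ K₂, ∑ s', ‖bondOp b s s'‖ * gapWeight A η s' ≤ η ^ (d - 1) := by
    intro b hb
    obtain ⟨hbK, -⟩ := Finset.mem_filter.1 hb
    refine (hbond b hbK).trans ?_
    split_ifs with hcond
    · rw [gapWeight]
      apply pow_le_pow_of_le_one hη0.le hη1
      have := excCount_le_excCount_hopBack_add (A := A) (hKne b hbK) (hKA b hbK).1 (hKA b hbK).2 hcond.1 hcond.2
      rw [hd, hk]
      omega
    · positivity
  -- counting the bonds at excited sites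
  have hK₂card : (K₂.card : ℝ) ≤ M * k := by
    have hsub : K₂ ⊆ (A.filter fun x => IsExcited s x).biUnion fun x => K.filter fun b => x ∈ Bond.verts b := by
      intro b hb
      obtain ⟨hbK, hex⟩ := Finset.mem_filter.1 hb
      rw [Finset.mem_biUnion]
      rcases hex with h | h
      · exact ⟨b.1, Finset.mem_filter.2 ⟨(hKA b hbK).1, h⟩, Finset.mem_filter.2 ⟨hbK, by simp [Bond.verts]⟩⟩
      · exact ⟨b.2.1, Finset.mem_filter.2 ⟨(hKA b hbK).2, h⟩, Finset.mem_filter.2 ⟨hbK, by simp [Bond.verts]⟩⟩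
    have h1 : K₂.card ≤ M * k := by
      calc K₂.card ≤ ((A.filter fun x => IsExcited s x).biUnion fun x => K.filter fun b => x ∈ Bond.verts b).card :=
            Finset.card_le_card hsub
        _ ≤ ∑ x ∈ A.filter (fun x => IsExcited s x), (K.filter fun b => x ∈ Bond.verts b).card := Finset.card_biUnion_le
        _ ≤ ∑ _x ∈ A.filter (fun x => IsExcited s x), M := Finset.sum_le_sum fun x _ => hM x
        _ = M * k := by rw [Finset.sum_const, smul_eq_mul, hk, excCount, mul_comm]
    exact_mod_cast h1
  have hK₁card : (K₁.card : ℝ) ≤ K.card := by exact_mod_cast Finset.card_filter_le _ _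
  have hhop : ∑ b ∈ K, ∑ s', ‖bondOp b s s'‖ * gapWeight A η s' ≤ K.card * η ^ (d + 1) + M * k * η ^ (d - 1) := by
    rw [hKsplit]
    refine add_le_add ?_ ?_
    · calc ∑ b ∈ K₁, ∑ s', ‖bondOp b s s'‖ * gapWeight A η s' ≤ ∑ _b ∈ K₁, η ^ (d + 1) := Finset.sum_le_sum h₁
        _ = K₁.card * η ^ (d + 1) := by rw [Finset.sum_const, nsmul_eq_mul]
        _ ≤ K.card * η ^ (d + 1) := mul_le_mul_of_nonneg_right hK₁card (by positivity)
    · calc ∑ b ∈ K₂, ∑ s', ‖bondOp b s s'‖ * gapWeight A η s' ≤ ∑ _b ∈ K₂, η ^ (d - 1) := Finset.sum_le_sum h₂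
        _ = K₂.card * η ^ (d - 1) := by rw [Finset.sum_const, nsmul_eq_mul]
        _ ≤ M * k * η ^ (d - 1) := mul_le_mul_of_nonneg_right hK₂card (by positivity)
  -- the diagonal part
  have hdiagle : (-(β * ∑ x ∈ A, onSiteEnergyAt U μ x s)).re ≤ a * A.card - δ * k :=
    re_neg_mul_sum_onSiteEnergyAt_le β U μ A s
  -- the gap pays for the hops at excited sites
  have hkey : g * (M * k * η ^ (d - 1)) ≤ δ * k * η ^ d := by
    rcases Nat.eq_zero_or_pos k with hk0 | hkpos
    · rw [hk0]; simp
    · have hd1 : 1 ≤ d := by rw [hd]; omega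
      have hpow : η ^ d = η ^ (d - 1) * η := by rw [← pow_succ, Nat.sub_add_cancel hd1]
      rw [hpow]
      have hk0 : (0 : ℝ) ≤ k := Nat.cast_nonneg _
      have hp0 : (0 : ℝ) ≤ η ^ (d - 1) := by positivity
      calc g * (M * k * η ^ (d - 1)) = (g * M) * (k * η ^ (d - 1)) := by ring
        _ ≤ (δ * η) * (k * η ^ (d - 1)) := mul_le_mul_of_nonneg_right hgap (by positivity)
        _ = δ * k * (η ^ (d - 1) * η) := by ring
  rw [hmul, hv]
  have hηd : (0 : ℝ) ≤ η ^ d := by positivity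
  calc (-(β * ∑ x ∈ A, onSiteEnergyAt U μ x s)).re * η ^ d + g * ∑ b ∈ K, ∑ s', ‖bondOp b s s'‖ * gapWeight A η s'
      ≤ (a * A.card - δ * k) * η ^ d + g * (K.card * η ^ (d + 1) + M * k * η ^ (d - 1)) :=
        add_le_add (mul_le_mul_of_nonneg_right hdiagle hηd) (mul_le_mul_of_nonneg_left hhop hg)
    _ = (a * A.card) * η ^ d + g * K.card * η * η ^ d + (g * (M * k * η ^ (d - 1)) - δ * k * η ^ d) := by ring
    _ ≤ (a * A.card) * η ^ d + g * K.card * η * η ^ d + 0 := by gcongr; linarith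
    _ = (a * A.card + g * K.card * η) * η ^ d := by ring

/-- **The gap bound on the trace**: for couplings supported in `K` and bounded by `g`,
`|Tr exp(-βV_A + Σ c_b T_b)| ≤ 4^{|Λ|} e^{a|A| + g|K|η}` under the hypotheses of the Lyapunov
inequality. [cite: Ueltschi1999, §3 (bound on ρ(𝒜) in D₂)] -/
theorem norm_trace_exp_le_of_gap (β U μ : ℂ) {A : Finset Λ} {K : Finset (Bond Λ)}
    (hKA : ∀ b ∈ K, b.1 ∈ A ∧ b.2.1 ∈ A) (hKne : ∀ b ∈ K, b.1 ≠ b.2.1) {M : ℕ}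
    (hM : ∀ x, (K.filter fun b => x ∈ Bond.verts b).card ≤ M) {g η : ℝ} (hg : 0 ≤ g) (hη0 : 0 < η) (hη1 : η ≤ 1)
    (hgap : g * M ≤ min (β * μ).re ((β * U).re - (β * μ).re) * η)
    {c : Bond Λ → ℂ} (hcK : ∀ b ∉ K, c b = 0) (hcg : ∀ b, ‖c b‖ ≤ g) :
    ‖(NormedSpace.exp (-(β • onSiteSum U μ A) + hopSum c)).trace‖ ≤
      (4 : ℝ) ^ Fintype.card Λ * Real.exp ((β * μ).re * A.card + g * K.card * η) := by
  classical
  set X : Matrix (Finset (Orb Λ)) (Finset (Orb Λ)) ℂ := -(β • onSiteSum U μ A) + hopSum c with hX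
  set Y := gapCompMatrix β U μ A K g with hY
  -- entries of `X`
  have hXapply : ∀ s s', X s s' = (if s = s' then -(β * ∑ x ∈ A, onSiteEnergyAt U μ x s) else 0) +
      ∑ b, c b * bondOp b s s' := by
    intro s s'
    have e1 : (-(β • onSiteSum U μ A)) s s' = if s = s' then -(β * ∑ x ∈ A, onSiteEnergyAt U μ x s) else 0 := by
      rw [Matrix.neg_apply, Matrix.smul_apply, onSiteSum_eq_diagonal, Matrix.diagonal_apply]
      split_ifs <;> simp
    have e2 : (hopSum c) s s' = ∑ b, c b * bondOp b s s' := by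
      simp only [hopSum, Matrix.sum_apply, Matrix.smul_apply, smul_eq_mul]
    rw [hX, Matrix.add_apply, e1, e2]
  have hhop : ∀ s s', ‖∑ b, c b * bondOp b s s'‖ ≤ g * ∑ b ∈ K, ‖bondOp b s s'‖ := by
    intro s s'
    have hvan : ∀ b ∈ (Finset.univ : Finset (Bond Λ)), b ∉ K → c b * bondOp b s s' = 0 := by
      intro b _ hb; rw [hcK b hb, zero_mul]
    rw [← Finset.sum_subset (Finset.subset_univ K) hvan, Finset.mul_sum]
    refine (norm_sum_le _ _).trans (Finset.sum_le_sum fun b _ => ?_)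
    rw [norm_mul]
    exact mul_le_mul_of_nonneg_right (hcg b) (norm_nonneg _)
  have hYapply : ∀ s s', Y s s' = (if s = s' then (-(β * ∑ x ∈ A, onSiteEnergyAt U μ x s)).re else 0) +
      g * ∑ b ∈ K, ‖bondOp b s s'‖ := by
    intro s s'
    rw [hY, gapCompMatrix, Matrix.add_apply, Matrix.diagonal_apply, Matrix.smul_apply, Matrix.of_apply, smul_eq_mul]
  have hoff : ∀ s s', s ≠ s' → ‖X s s'‖ ≤ Y s s' := by
    intro s s' hss'
    rw [hXapply, hYapply, if_neg hss', if_neg hss', zero_add, zero_add]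
    exact hhop s s'
  have hdiag : ∀ s, (X s s).re ≤ Y s s := by
    intro s
    rw [hXapply, hYapply, if_pos rfl, if_pos rfl, Complex.add_re]
    refine add_le_add le_rfl ((Complex.re_le_norm _).trans (hhop s s))
  have h := norm_trace_exp_le_card_mul_exp hoff hdiag (gapWeight_pos A hη0)
    (gapCompMatrix_mulVec_le β U μ hKA hKne hM hg hη0 hη1 hgap)
  rw [Fintype.card_finset, Fintype.card_lex, Fintype.card_prod, Fintype.card_fin] at h
  refine h.trans (le_of_eq ?_)
  congr 1
  rw [pow_mul']
  norm_num

variable {β U μ : ℂ}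

/-- **The gap bound on the normalised Gibbs factor.** For couplings supported on a bond set `K`
joining distinct sites of `A`, with at most `M` bonds of `K` at any site, `|c_b| ≤ g`, and
`0 < η ≤ 1`, `g M ≤ δ η` (`δ = min(re βμ, re βU - re βμ)`):
`|g(c)| ≤ (2r)^{|A|} e^{g|K|η}` with the site ratio `r`. Unlike `norm_gibbsRatio_le` there is no
factor `e^{‖Σ c T‖}`: a large hopping is paid by the gap. [cite: Ueltschi1999, §3 (Theorem 3.1 on D₂: |ρ(𝒜)| ≤ e^{-c|𝒜|} when βt²/Δ and t/Δ are small)] -/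
theorem norm_gibbsRatio_le_of_gap (hz : atomicPartitionFn β U μ ≠ 0) {A : Finset Λ} {K : Finset (Bond Λ)}
    (hKA : ∀ b ∈ K, b.1 ∈ A ∧ b.2.1 ∈ A) (hKne : ∀ b ∈ K, b.1 ≠ b.2.1) {M : ℕ}
    (hM : ∀ x, (K.filter fun b => x ∈ Bond.verts b).card ≤ M) {g η : ℝ} (hg : 0 ≤ g) (hη0 : 0 < η) (hη1 : η ≤ 1)
    (hgap : g * M ≤ min (β * μ).re ((β * U).re - (β * μ).re) * η)
    {c : Bond Λ → ℂ} (hcK : ∀ b ∉ K, c b = 0) (hcg : ∀ b, ‖c b‖ ≤ g) :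
    ‖gibbsRatio β U μ c‖ ≤ (2 * siteRatio β U μ) ^ A.card * Real.exp (g * K.card * η) := by
  classical
  have hc : ∀ b, c b ≠ 0 → b.1 ∈ A ∧ b.2.1 ∈ A := by
    intro b hb
    have hbK : b ∈ K := by by_contra h; exact hb (hcK b h)
    exact hKA b hbK
  rw [gibbsRatio_eq_div hz hc, norm_div, trace_exp_neg_onSiteSum, norm_mul, norm_pow, norm_pow]
  have h4 : ‖(4 : ℂ)‖ = 4 := by norm_num
  rw [h4]
  have hz' : 0 < ‖atomicPartitionFn β U μ‖ := norm_pos_iff.2 hz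
  have hden : 0 < ‖atomicPartitionFn β U μ‖ ^ A.card * (4 : ℝ) ^ (Fintype.card Λ - A.card) := by positivity
  rw [div_le_iff₀ hden]
  have hA : A.card ≤ Fintype.card Λ := Finset.card_le_univ A
  set a : ℝ := (β * μ).re with ha
  -- `4^{|Λ|} e^{a|A|} = (4 e^a)^{|A|} 4^{|Λ|-|A|}` and `4 e^a ≤ 2 z₀ʳ = 2 r |z₀|`
  have hea : 4 * Real.exp a ≤ 2 * siteRatio β U μ * ‖atomicPartitionFn β U μ‖ := by
    rw [siteRatio, mul_assoc, div_mul_cancel₀ _ hz'.ne']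
    have := two_mul_exp_le_atomicPartitionFnReal (β * U).re a
    linarith
  calc ‖(NormedSpace.exp (-(β • onSiteSum U μ A) + hopSum c)).trace‖
      ≤ (4 : ℝ) ^ Fintype.card Λ * Real.exp (a * A.card + g * K.card * η) :=
        norm_trace_exp_le_of_gap β U μ hKA hKne hM hg hη0 hη1 hgap hcK hcg
    _ = (4 * Real.exp a) ^ A.card * Real.exp (g * K.card * η) * (4 : ℝ) ^ (Fintype.card Λ - A.card) := by
        rw [Real.exp_add, mul_pow, ← Real.exp_nat_mul, mul_comm (A.card : ℝ) a]
        rw [show (4 : ℝ) ^ Fintype.card Λ = 4 ^ A.card * 4 ^ (Fintype.card Λ - A.card) by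
          rw [← pow_add, Nat.add_sub_cancel' hA]]
        ring
    _ ≤ (2 * siteRatio β U μ * ‖atomicPartitionFn β U μ‖) ^ A.card * Real.exp (g * K.card * η) *
          (4 : ℝ) ^ (Fintype.card Λ - A.card) := by
        gcongr
    _ = (2 * siteRatio β U μ) ^ A.card * Real.exp (g * K.card * η) *
          (‖atomicPartitionFn β U μ‖ ^ A.card * (4 : ℝ) ^ (Fintype.card Λ - A.card)) := by
        rw [mul_pow]; ring

/-- The `η`-optimised form: if `δ > 0` and `g M ≤ δ` then `|g(c)| ≤ (2r)^{|A|} e^{g² M |K| / δ}`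
(`η = gM/δ`). [cite: Ueltschi1999, §3 (Theorem 3.1 on D₂)] -/
theorem norm_gibbsRatio_le_of_gap' (hz : atomicPartitionFn β U μ ≠ 0) {A : Finset Λ} {K : Finset (Bond Λ)}
    (hKA : ∀ b ∈ K, b.1 ∈ A ∧ b.2.1 ∈ A) (hKne : ∀ b ∈ K, b.1 ≠ b.2.1) {M : ℕ}
    (hM : ∀ x, (K.filter fun b => x ∈ Bond.verts b).card ≤ M) {g : ℝ} (hg : 0 ≤ g)
    (hδ : 0 < min (β * μ).re ((β * U).re - (β * μ).re)) (hgap : g * M ≤ min (β * μ).re ((β * U).re - (β * μ).re))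
    {c : Bond Λ → ℂ} (hcK : ∀ b ∉ K, c b = 0) (hcg : ∀ b, ‖c b‖ ≤ g) :
    ‖gibbsRatio β U μ c‖ ≤ (2 * siteRatio β U μ) ^ A.card *
      Real.exp (g ^ 2 * M * K.card / min (β * μ).re ((β * U).re - (β * μ).re)) := by
  set δ : ℝ := min (β * μ).re ((β * U).re - (β * μ).re) with hδdef
  by_cases hgM : g * M = 0
  · -- degenerate: `g = 0` or `M = 0` (then `K = ∅`); take `η = 1`
    have h := norm_gibbsRatio_le_of_gap hz hKA hKne hM hg one_pos le_rfl (by rw [hgM, mul_one]; exact hδ.le) hcK hcg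
    refine h.trans (mul_le_mul_of_nonneg_left ?_ (pow_nonneg (mul_nonneg zero_le_two (siteRatio_nonneg β U μ)) _))
    rw [Real.exp_le_exp]
    rcases mul_eq_zero.1 hgM with h0 | h0
    · rw [h0]; simp
    · have hK : K = ∅ := by
        by_contra hK
        obtain ⟨b, hb⟩ := Finset.nonempty_iff_ne_empty.2 hK
        have h1 : 1 ≤ (K.filter fun b' => b.1 ∈ Bond.verts b').card :=
          Finset.card_pos.2 ⟨b, Finset.mem_filter.2 ⟨hb, by simp [Bond.verts]⟩⟩
        have h2 := hM b.1
        have h3 : (M : ℝ) = 0 := h0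
        have h4 : M = 0 := by exact_mod_cast h3
        omega
      rw [hK]; simp
  · have hgMpos : 0 < g * M := lt_of_le_of_ne (by positivity) (Ne.symm hgM)
    set η : ℝ := g * M / δ with hη
    have hη0 : 0 < η := div_pos hgMpos hδ
    have hη1 : η ≤ 1 := (div_le_one hδ).2 hgap
    have hgap' : g * M ≤ δ * η := by rw [hη, mul_div_cancel₀ _ hδ.ne']
    have h := norm_gibbsRatio_le_of_gap hz hKA hKne hM hg hη0 hη1 hgap' hcK hcg
    refine h.trans (le_of_eq ?_)
    congr 2
    rw [hη, div_eq_mul_inv, div_eq_mul_inv]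
    ring

end GapBound

/-! ### The gap bound on the bond weights -/

section BondWeightGap

variable {Λ : Type*} [LinearOrder Λ] [Fintype Λ] {G : SimpleGraph Λ} [DecidableRel G.Adj] {Δ : ℕ} {β U μ : ℂ}

/-- **Smallness per bond in the gapped regime.** On a graph of maximal degree `Δ`, for a set `K`
of bonds of the graph, `ϱ ≥ 1`, `δ = min(re βμ, re βU - re βμ) > 0` and
`(1+ϱ) · 4Δ · |τ| ≤ δ`:
`|M(K)| ≤ ϱ^{-|K|} (2r)^{|supp K|} exp((1+ϱ)² |τ|² 4Δ |K| / δ)`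
(Cauchy bound for the iterated difference with radius `ϱ|τ|`, and the gap bound on the
polydisc `|c_b| ≤ (1+ϱ)|τ|`). At real parameters `|τ| = βt`, `δ = βΔ_gap`, so the hypotheses read
`t/Δ_gap` small and the exponent is `βt²/Δ_gap` — Ueltschi's domain `D₂`.
[cite: Ueltschi1999, Theorem 3.1 (domain D₂) and §3 (|ρ(𝒜)| ≤ e^{-c|𝒜|} for βt²/Δ < 2χε²(1 - 2t/εΔ))] -/
theorem norm_bondWeight_le_of_gap (hΔ : ∀ v : Λ, (Finset.univ.filter (G.Adj v)).card ≤ Δ)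
    (hz : atomicPartitionFn β U μ ≠ 0) {K : Finset (Bond Λ)} (hK : K ⊆ hubbardBonds G)
    {ϱ : ℝ} (hϱ : 1 ≤ ϱ) {τ : ℂ} (hδ : 0 < min (β * μ).re ((β * U).re - (β * μ).re))
    (hτ : (1 + ϱ) * (4 * Δ) * ‖τ‖ ≤ min (β * μ).re ((β * U).re - (β * μ).re)) :
    ‖bondWeight β U μ τ K‖ ≤
      ϱ⁻¹ ^ K.card * (2 * siteRatio β U μ) ^ (cellSupp Bond.verts K).card *
        Real.exp (((1 + ϱ) * ‖τ‖) ^ 2 * (4 * Δ) * K.card / min (β * μ).re ((β * U).re - (β * μ).re)) := by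
  classical
  set δ : ℝ := min (β * μ).re ((β * U).re - (β * μ).re) with hδdef
  have hKA : ∀ b ∈ K, b.1 ∈ cellSupp Bond.verts K ∧ b.2.1 ∈ cellSupp Bond.verts K :=
    fun b hb => endpoints_mem_cellSupp hb
  have hKne : ∀ b ∈ K, b.1 ≠ b.2.1 := fun b hb => G.ne_of_adj ((mem_hubbardBonds (G := G)).1 (hK hb))
  have hM : ∀ x, (K.filter fun b => x ∈ Bond.verts b).card ≤ 4 * Δ := fun x =>
    (Finset.card_le_card (Finset.filter_subset_filter _ hK)).trans (card_hubbardBonds_mem_verts_le hΔ x)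
  have hr0 : 0 ≤ 2 * siteRatio β U μ := by have := siteRatio_nonneg β U μ; positivity
  by_cases hτ0 : τ = 0
  · -- `τ = 0`: the weight of a nonempty `K` vanishes, `M(∅) = 1`
    rcases K.eq_empty_or_nonempty with hK0 | hKne'
    · rw [hK0, bondWeight_empty hz]
      simp [cellSupp]
    · have hB : ∀ c' : Bond Λ → ℂ, (∀ b, ‖c' b‖ ≤ ‖τ‖ + 1) → (∀ b ∉ K, c' b = 0) →
          ‖gibbsRatio β U μ c'‖ ≤ Real.exp (2 * K.card) * siteRatio β U μ ^ (cellSupp Bond.verts K).card := by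
        intro c' hc' hK'
        have hsupp : ∀ b, c' b ≠ 0 → b.1 ∈ cellSupp Bond.verts K ∧ b.2.1 ∈ cellSupp Bond.verts K := by
          intro b hb
          have hbK : b ∈ K := by by_contra h; exact hb (hK' b h)
          exact endpoints_mem_cellSupp hbK
        refine (norm_gibbsRatio_le hz hsupp).trans (mul_le_mul_of_nonneg_right ?_ (pow_nonneg (siteRatio_nonneg _ _ _) _))
        rw [Real.exp_le_exp]
        refine (norm_hopSum_le_mul_card (s := 2) (fun b => (hc' b).trans (by rw [hτ0, norm_zero]; norm_num)) hK').trans ?_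
        linarith
      have h := norm_iterDiff_zero_le (differentiable_gibbsRatio β U μ) one_pos K hB
      rw [bondWeight]
      refine h.trans ?_
      rw [hτ0, norm_zero, zero_div, zero_pow (Finset.card_pos.2 hKne').ne', zero_mul]
      positivity
  · -- `τ ≠ 0`: Cauchy bound with radius `ϱ|τ|`
    have hτpos : 0 < ‖τ‖ := norm_pos_iff.2 hτ0
    have hR : 0 < ϱ * ‖τ‖ := by positivity
    set g : ℝ := (1 + ϱ) * ‖τ‖ with hg
    have hg0 : 0 ≤ g := by positivity
    have hgap : g * (4 * Δ : ℕ) ≤ δ := by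
      push_cast
      calc g * (4 * Δ) = (1 + ϱ) * (4 * Δ) * ‖τ‖ := by rw [hg]; ring
        _ ≤ δ := hτ
    have hB : ∀ c' : Bond Λ → ℂ, (∀ b, ‖c' b‖ ≤ ‖τ‖ + ϱ * ‖τ‖) → (∀ b ∉ K, c' b = 0) →
        ‖gibbsRatio β U μ c'‖ ≤ (2 * siteRatio β U μ) ^ (cellSupp Bond.verts K).card *
          Real.exp (g ^ 2 * (4 * Δ : ℕ) * K.card / δ) := by
      intro c' hc' hK'
      refine norm_gibbsRatio_le_of_gap' hz hKA hKne hM hg0 hδ hgap hK' fun b => (hc' b).trans (le_of_eq ?_)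
      rw [hg]; ring
    have h := norm_iterDiff_zero_le (differentiable_gibbsRatio β U μ) hR K hB
    rw [bondWeight]
    refine h.trans (le_of_eq ?_)
    have h1 : ‖τ‖ / (ϱ * ‖τ‖) = ϱ⁻¹ := by field_simp
    rw [h1]
    push_cast
    ring

end BondWeightGap

/-! ### Kotecký–Preiss smallness of the site activity from a per-bond-set bound -/

section SmallnessGeneral

variable {Λ : Type*} [LinearOrder Λ] [Fintype Λ] {G : SimpleGraph Λ} [DecidableRel G.Adj] {Δ : ℕ} {β U μ : ℂ}

/-- **One-site Kotecký–Preiss smallness of the Hubbard site activity from a per-bond-set bound**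
(finite volume, graph of maximal degree `Δ`): if every set `X` of bonds of the graph
satisfies `|M(X)| e^{2|supp X|} ≤ λ^{|X|}` with `(8Δ+1)² λ ≤ 1/2`, then for every site `x` and
every finite family `𝒜` of site sets containing `x`, `Σ_{A ∈ 𝒜} |siteActivity A| e^{2|A|} ≤ 8Δλ`
(the lattice-animal count of `sum_norm_siteActivity_mul_exp_le`, with the smallness per bond as a
hypothesis). [cite: Ueltschi1999, §2.3 and §3 (|ρ(𝒜)| ≤ e^{-c|𝒜|} and the entropy constant ℶ of connected sets)] -/
theorem sum_norm_siteActivity_mul_exp_le_of_bondWeight_le (hΔ : ∀ v : Λ, (Finset.univ.filter (G.Adj v)).card ≤ Δ)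
    {τ : ℂ} {lam : ℝ} (hlam0 : 0 ≤ lam) (hsmall : ((8 * Δ : ℕ) + 1 : ℝ) ^ 2 * lam ≤ 1 / 2)
    (hB : ∀ X ⊆ hubbardBonds G,
      ‖bondWeight β U μ τ X‖ * Real.exp (2 * (cellSupp Bond.verts X).card) ≤ lam ^ X.card)
    (x : Λ) (𝒜 : Finset (Finset Λ)) (h𝒜 : ∀ A ∈ 𝒜, x ∈ A) :
    ∑ A ∈ 𝒜, ‖siteActivity G β U μ τ A‖ * Real.exp (2 * A.card) ≤ 8 * Δ * lam := by
  classical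
  set D := hubbardBonds G with hD
  set CC := connectedCellSets Bond.verts D with hCC
  set f : Finset (Bond Λ) → ℝ := fun X => ‖bondWeight β U μ τ X‖ * Real.exp (2 * (cellSupp Bond.verts X).card) with hf
  have hf0 : ∀ X, 0 ≤ f X := fun X => by positivity
  -- Step a: bound by a sum over connected bond sets through `x`
  set Sx := CC.filter fun X => x ∈ cellSupp Bond.verts X with hSx
  have stepA : ∑ A ∈ 𝒜, ‖siteActivity G β U μ τ A‖ * Real.exp (2 * A.card) ≤ ∑ X ∈ Sx, f X := by
    have h1 : ∀ A ∈ 𝒜, ‖siteActivity G β U μ τ A‖ * Real.exp (2 * A.card) ≤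
        ∑ X ∈ CC.filter (fun X => cellSupp Bond.verts X = A), f X := by
      intro A _
      rw [siteActivity_apply, ← hD, ← hCC]
      refine (mul_le_mul_of_nonneg_right (norm_sum_le _ _) (Real.exp_nonneg _)).trans ?_
      rw [Finset.sum_mul]
      refine Finset.sum_le_sum fun X hX => le_of_eq ?_
      simp only [hf]
      rw [(Finset.mem_filter.1 hX).2]
    refine (Finset.sum_le_sum h1).trans ?_
    rw [← Finset.sum_biUnion]
    · refine Finset.sum_le_sum_of_subset_of_nonneg ?_ fun X _ _ => hf0 X
      intro X hX
      obtain ⟨A, hA, hXA⟩ := Finset.mem_biUnion.1 hX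
      obtain ⟨hXCC, hXsupp⟩ := Finset.mem_filter.1 hXA
      exact Finset.mem_filter.2 ⟨hXCC, hXsupp ▸ h𝒜 A hA⟩
    · intro A hA B hB hAB
      refine Finset.disjoint_left.2 fun X hXA hXB => hAB ?_
      rw [← (Finset.mem_filter.1 hXA).2, ← (Finset.mem_filter.1 hXB).2]
  -- Step b: each term is at most `λ^{|X|}` (the hypothesis)
  have stepB : ∀ X ∈ Sx, f X ≤ lam ^ X.card :=
    fun X hX => hB X (mem_connectedCellSets.1 (Finset.mem_filter.1 hX).1).1
  -- Step c: cover `Sx` by the families through the bonds at `x`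
  set Bx := D.filter fun b => x ∈ Bond.verts b with hBx
  have hcover : Sx ⊆ Bx.biUnion fun b₀ => CC.filter fun X => b₀ ∈ X := by
    intro X hX
    obtain ⟨hXCC, hx⟩ := Finset.mem_filter.1 hX
    obtain ⟨b₀, hb₀X, hxb₀⟩ := mem_cellSupp.1 hx
    have hb₀D : b₀ ∈ D := (mem_connectedCellSets.1 hXCC).1 hb₀X
    exact Finset.mem_biUnion.2 ⟨b₀, Finset.mem_filter.2 ⟨hb₀D, hxb₀⟩, Finset.mem_filter.2 ⟨hXCC, hb₀X⟩⟩
  have stepC : ∑ X ∈ Sx, lam ^ X.card ≤ ∑ b₀ ∈ Bx, ∑ X ∈ CC.filter (fun X => b₀ ∈ X), lam ^ X.card :=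
    (Finset.sum_le_sum_of_subset_of_nonneg hcover fun X _ _ => pow_nonneg hlam0 _).trans
      (sum_biUnion_le_sum_of_nonneg Bx _ _ fun X => pow_nonneg hlam0 _)
  -- Step d/e: entropy bound and the number of bonds at `x`
  have stepD : ∀ b₀ ∈ Bx, ∑ X ∈ CC.filter (fun X => b₀ ∈ X), lam ^ X.card ≤ 2 * lam :=
    fun b₀ _ => sum_pow_card_connectedCellSets_le hΔ hlam0 hsmall b₀
  have stepE : (Bx.card : ℝ) ≤ 4 * Δ := by exact_mod_cast card_hubbardBonds_mem_verts_le hΔ x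
  calc ∑ A ∈ 𝒜, ‖siteActivity G β U μ τ A‖ * Real.exp (2 * A.card)
      ≤ ∑ X ∈ Sx, f X := stepA
    _ ≤ ∑ X ∈ Sx, lam ^ X.card := Finset.sum_le_sum stepB
    _ ≤ ∑ b₀ ∈ Bx, ∑ X ∈ CC.filter (fun X => b₀ ∈ X), lam ^ X.card := stepC
    _ ≤ ∑ _b₀ ∈ Bx, 2 * lam := Finset.sum_le_sum stepD
    _ = Bx.card * (2 * lam) := by rw [Finset.sum_const, nsmul_eq_mul]
    _ ≤ 4 * Δ * (2 * lam) := mul_le_mul_of_nonneg_right stepE (by positivity)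
    _ = 8 * Δ * lam := by ring

end SmallnessGeneral

/-! ### Smallness of the lattice activity on `ℤ²` in the gapped regime -/

section SmallnessGap

/-- The radius constant `ϱ = 2178 e⁹` of the Cauchy estimate in the gapped regime (so that
`e⁹ / ϱ = 1/2178 = λ` satisfies `33² λ = 1/2` on `ℤ²`). [cite: Ueltschi1999, §3 (Theorem 3.1 on D₂: explicit but non-optimal constants)] -/
def gapRho : ℝ := 2178 * Real.exp 9

/-- `ϱ ≥ 1`. [folklore] -/
theorem one_le_gapRho : 1 ≤ gapRho := by
  unfold gapRho
  have : (1 : ℝ) ≤ Real.exp 9 := Real.one_le_exp (by norm_num)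
  nlinarith

/-- `ϱ > 0`. [folklore] -/
theorem gapRho_pos : 0 < gapRho := lt_of_lt_of_le one_pos one_le_gapRho

variable {β U μ : ℂ}

/-- **The per-bond smallness on a graph of maximal degree `4` in the gapped regime**, in the form
required by the lattice-animal count: `|M(X)| e^{2|supp X|} ≤ (1/2178)^{|X|}` for bond sets `X` of
the graph, as soon as `z₀ ≠ 0`, `r ≤ 2`, `δ = min(re βμ, re βU - re βμ) > 0`,
`16(1+ϱ)|τ| ≤ δ` and `16(1+ϱ)²|τ|² ≤ δ`. [cite: Ueltschi1999, §3 (Theorem 3.1 on D₂)] -/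
theorem norm_bondWeight_mul_exp_le_of_gap {Λ : Type*} [LinearOrder Λ] [Fintype Λ] {G : SimpleGraph Λ} [DecidableRel G.Adj]
    (hΔ : ∀ v : Λ, (Finset.univ.filter (G.Adj v)).card ≤ 4) (hz : atomicPartitionFn β U μ ≠ 0)
    (hr : siteRatio β U μ ≤ 2) {τ : ℂ} (hδ : 0 < min (β * μ).re ((β * U).re - (β * μ).re))
    (hτ1 : (1 + gapRho) * 16 * ‖τ‖ ≤ min (β * μ).re ((β * U).re - (β * μ).re))
    (hτ2 : ((1 + gapRho) * ‖τ‖) ^ 2 * 16 ≤ min (β * μ).re ((β * U).re - (β * μ).re))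
    {X : Finset (Bond Λ)} (hX : X ⊆ hubbardBonds G) :
    ‖bondWeight β U μ τ X‖ * Real.exp (2 * (cellSupp Bond.verts X).card) ≤ (1 / 2178 : ℝ) ^ X.card := by
  set δ : ℝ := min (β * μ).re ((β * U).re - (β * μ).re) with hδdef
  set k := X.card with hk
  set m := (cellSupp Bond.verts X).card with hm
  have hbw := norm_bondWeight_le_of_gap (Δ := 4) hΔ hz hX one_le_gapRho hδ
    (by push_cast; calc (1 + gapRho) * (4 * 4) * ‖τ‖ = (1 + gapRho) * 16 * ‖τ‖ := by ring
      _ ≤ δ := hτ1)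
  have hr0 : 0 ≤ siteRatio β U μ := siteRatio_nonneg β U μ
  have hϱ := gapRho_pos
  -- the exponent is at most `k`
  have hE : ((1 + gapRho) * ‖τ‖) ^ 2 * (4 * (4 : ℕ)) * k / δ ≤ k := by
    rw [div_le_iff₀ hδ]
    push_cast
    have hk0 : (0 : ℝ) ≤ k := Nat.cast_nonneg _
    calc ((1 + gapRho) * ‖τ‖) ^ 2 * (4 * 4) * k = (((1 + gapRho) * ‖τ‖) ^ 2 * 16) * k := by ring
      _ ≤ δ * k := mul_le_mul_of_nonneg_right hτ2 hk0
      _ = k * δ := mul_comm _ _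
  have hms : m ≤ 2 * k := card_cellSupp_le X
  -- `(2r)^m ≤ 4^m ≤ e^{2m}`
  have h4e : (4 : ℝ) ≤ Real.exp 2 := by
    have h1 : (2 : ℝ) ≤ Real.exp 1 := by have := Real.add_one_le_exp (1 : ℝ); linarith
    have h2 : Real.exp 2 = Real.exp 1 * Real.exp 1 := by rw [← Real.exp_add]; norm_num
    rw [h2]; nlinarith
  have h2r : (2 * siteRatio β U μ) ^ m ≤ Real.exp (m * 2) := by
    rw [Real.exp_nat_mul]
    exact pow_le_pow_left₀ (by positivity) (by linarith) m
  have hexp : Real.exp (m * 2) * Real.exp k * Real.exp (2 * m) ≤ Real.exp (k * 9) := by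
    rw [← Real.exp_add, ← Real.exp_add, Real.exp_le_exp]
    have : (m : ℝ) ≤ 2 * k := by exact_mod_cast hms
    linarith
  calc ‖bondWeight β U μ τ X‖ * Real.exp (2 * m)
      ≤ gapRho⁻¹ ^ k * (2 * siteRatio β U μ) ^ m * Real.exp (((1 + gapRho) * ‖τ‖) ^ 2 * (4 * (4 : ℕ)) * k / δ) *
          Real.exp (2 * m) := mul_le_mul_of_nonneg_right hbw (Real.exp_nonneg _)
    _ ≤ gapRho⁻¹ ^ k * Real.exp (m * 2) * Real.exp k * Real.exp (2 * m) := by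
        gcongr
    _ = gapRho⁻¹ ^ k * (Real.exp (m * 2) * Real.exp k * Real.exp (2 * m)) := by ring
    _ ≤ gapRho⁻¹ ^ k * Real.exp (k * 9) := mul_le_mul_of_nonneg_left hexp (by positivity)
    _ = (gapRho⁻¹ * Real.exp 9) ^ k := by rw [Real.exp_nat_mul, mul_pow]
    _ = (1 / 2178 : ℝ) ^ k := by
        congr 1
        unfold gapRho
        have : Real.exp 9 ≠ 0 := (Real.exp_pos 9).ne'
        field_simp

/-- **Kotecký–Preiss smallness of the Hubbard lattice activity on `ℤ²` in the gapped regime**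
(`δ = 1`): for `z₀ ≠ 0`, site ratio `r ≤ 2`, gap `δ = min(re βμ, re βU - re βμ) > 0` and
`16(1+ϱ)|τ| ≤ δ`, `16(1+ϱ)²|τ|² ≤ δ`, the lattice activity is a small translation-invariant
activity. At real parameters (`|τ| = βt`, `δ = βΔ`) the hypotheses are `t/Δ ≤ (16(1+ϱ))⁻¹` and
`βt²/Δ ≤ (16(1+ϱ)²)⁻¹`, the shape of Ueltschi's domain `D₂` (his proof organises the same
Duhamel terms into space–time loops; here the gap is exploited through a comparison semigroup and
a Lyapunov vector, `norm_gibbsRatio_le_of_gap`). [cite: Ueltschi1999, Theorem 3.1 (domain D₂) via Proposition 2.2] -/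
theorem isSmallTIActivity_latticeActivity_of_gap (hz : atomicPartitionFn β U μ ≠ 0) (hr : siteRatio β U μ ≤ 2)
    {τ : ℂ} (hδ : 0 < min (β * μ).re ((β * U).re - (β * μ).re))
    (hτ1 : (1 + gapRho) * 16 * ‖τ‖ ≤ min (β * μ).re ((β * U).re - (β * μ).re))
    (hτ2 : ((1 + gapRho) * ‖τ‖) ^ 2 * 16 ≤ min (β * μ).re ((β * U).re - (β * μ).re)) :
    IsSmallTIActivity (latticeActivity 2 β U μ τ) 1 where
  shift_invariant v A := latticeActivity_shiftSet hz τ v A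
  eq_zero_of_not_isRConnected A hA := by
    by_contra h
    exact hA (isRConnected_of_latticeActivity_ne_zero h)
  delta_pos := one_pos
  sum_le_one x 𝒜 h𝒜 := by
    classical
    -- a box containing all the sets of the family
    set L : ℕ := (𝒜.biUnion id ∪ {x}).sup Site.supNorm with hL
    have hbox : ∀ A ∈ 𝒜, A ⊆ box 2 L := by
      intro A hA y hy
      rw [mem_box_iff_supNorm_le]
      exact Finset.le_sup (f := Site.supNorm) (Finset.mem_union_left _ (Finset.mem_biUnion.2 ⟨A, hA, hy⟩))
    have hxbox : x ∈ box 2 L := by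
      rw [mem_box_iff_supNorm_le]
      exact Finset.le_sup (f := Site.supNorm) (Finset.mem_union_right _ (Finset.mem_singleton_self x))
    -- pass to box coordinates
    set x' : FermionBox 2 L := ofSite L x with hx'
    have hxx' : FermionBox.toSite x' = x := toSite_ofSite hxbox
    set 𝒜' : Finset (Finset (FermionBox 2 L)) := 𝒜.image (boxPre L) with h𝒜'
    have hinj : Set.InjOn (boxPre L) (𝒜 : Set (Finset (Site 2))) := by
      intro A hA B hB h
      rw [← map_boxPre (hbox A hA), ← map_boxPre (hbox B hB), h]
    have hmem : ∀ A' ∈ 𝒜', x' ∈ A' := by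
      intro A' hA'
      obtain ⟨A, hA, rfl⟩ := Finset.mem_image.1 hA'
      exact Finset.mem_filter.2 ⟨Finset.mem_univ _, by rw [hxx']; exact h𝒜 A hA⟩
    have hterm : ∀ A ∈ 𝒜, ‖latticeActivity 2 β U μ τ A‖ * Real.exp ((1 + 1) * A.card) =
        ‖siteActivity (fermionBoxGraph 2 L) β U μ τ (boxPre L A)‖ * Real.exp (2 * (boxPre L A).card) := by
      intro A hA
      rw [siteActivity_fermionBox hz, map_boxPre (hbox A hA), ← Finset.card_map (siteEmb (boxEmb 2 L)), map_boxPre (hbox A hA)]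
      norm_num
    rw [Finset.sum_congr rfl hterm, ← Finset.sum_image
      (f := fun A' => ‖siteActivity (fermionBoxGraph 2 L) β U μ τ A'‖ * Real.exp (2 * (A'.card : ℝ))) hinj]
    -- the finite-volume smallness in the box, from the per-bond bound in the gapped regime
    have h := sum_norm_siteActivity_mul_exp_le_of_bondWeight_le (G := fermionBoxGraph 2 L) (Δ := 4)
      (fun v => card_filter_fermionBoxGraph_adj_le v) (lam := 1 / 2178) (by norm_num) (by norm_num)
      (fun X hX => norm_bondWeight_mul_exp_le_of_gap (fun v => card_filter_fermionBoxGraph_adj_le v) hz hr hδ hτ1 hτ2 hX)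
      x' 𝒜' hmem
    refine h.trans ?_
    norm_num

end SmallnessGap

/-! ### The admissible complex domain in the gapped regime -/

section AdmissibleGap

/-- The gap `δ(β, μ) = min(re βμ, re βU - re βμ)` as a function of complex `(β, μ)` (real `U`);
at real parameters `δ = β · min(μ, U - μ)`. [cite: Ueltschi1999, Theorem 3.1 (Δ = min(μ, U-μ))] -/
def gapOf (U : ℝ) (z : ℂ × ℂ) : ℝ := min (z.1 * z.2).re ((z.1 * (U : ℂ)).re - (z.1 * z.2).re)

/-- `gapOf` is continuous. [folklore] -/
theorem continuous_gapOf (U : ℝ) : Continuous (gapOf U) := by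
  unfold gapOf
  fun_prop

/-- **The admissible domain in the gapped regime** for fixed real `U`, `t`: `z₀ ≠ 0`, site
ratio `< 2`, positive gap and the two smallness conditions of
`isSmallTIActivity_latticeActivity_of_gap` with `τ = βt`, all strict. [cite: Ueltschi1999, Theorem 3.1 (domain D₂)] -/
def admissibleSetGap (U t : ℝ) : Set (ℂ × ℂ) :=
  {z | atomicPartitionFn z.1 U z.2 ≠ 0 ∧ siteRatio z.1 U z.2 < 2 ∧ 0 < gapOf U z ∧
    (1 + gapRho) * 16 * (‖z.1‖ * t) < gapOf U z ∧ ((1 + gapRho) * (‖z.1‖ * t)) ^ 2 * 16 < gapOf U z}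

/-- The admissible domain in the gapped regime is open. [folklore] -/
theorem isOpen_admissibleSetGap (U t : ℝ) : IsOpen (admissibleSetGap U t) := by
  have hO : IsOpen {z : ℂ × ℂ | atomicPartitionFn z.1 U z.2 ≠ 0} :=
    isOpen_ne_fun (differentiable_atomicPartitionFn (U : ℂ)).continuous continuous_const
  have h1 : IsOpen ({z : ℂ × ℂ | atomicPartitionFn z.1 U z.2 ≠ 0} ∩ (fun z : ℂ × ℂ => siteRatio z.1 U z.2) ⁻¹' Set.Iio 2) :=
    (continuousOn_siteRatio (U : ℂ)).isOpen_inter_preimage hO isOpen_Iio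
  have hc := continuous_gapOf U
  have h2 : IsOpen {z : ℂ × ℂ | 0 < gapOf U z} := isOpen_lt continuous_const hc
  have h3 : IsOpen {z : ℂ × ℂ | (1 + gapRho) * 16 * (‖z.1‖ * t) < gapOf U z} := isOpen_lt (by fun_prop) hc
  have h4 : IsOpen {z : ℂ × ℂ | ((1 + gapRho) * (‖z.1‖ * t)) ^ 2 * 16 < gapOf U z} := isOpen_lt (by fun_prop) hc
  have heq : admissibleSetGap U t =
      ({z : ℂ × ℂ | atomicPartitionFn z.1 U z.2 ≠ 0} ∩ (fun z : ℂ × ℂ => siteRatio z.1 U z.2) ⁻¹' Set.Iio 2) ∩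
        {z : ℂ × ℂ | 0 < gapOf U z} ∩ {z : ℂ × ℂ | (1 + gapRho) * 16 * (‖z.1‖ * t) < gapOf U z} ∩
          {z : ℂ × ℂ | ((1 + gapRho) * (‖z.1‖ * t)) ^ 2 * 16 < gapOf U z} := by
    ext z
    simp only [admissibleSetGap, Set.mem_setOf_eq, Set.mem_inter_iff, Set.mem_preimage, Set.mem_Iio, and_assoc]
  rw [heq]
  exact ((h1.inter h2).inter h3).inter h4

/-- **Real points of `D₂` are admissible**: `β > 0`, `0 < μ < U`, `16(1+ϱ) t < Δ` and
`16(1+ϱ)² βt² < Δ` with `Δ = min(μ, U - μ)`. [cite: Ueltschi1999, Theorem 3.1 (D₂ = {0 < μ < U, βt²/Δ < 2χε²(1 - 2t/εΔ)})] -/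
theorem mem_admissibleSetGap_of_real {U t β μ : ℝ} (hβ : 0 < β) (hμ : 0 < μ) (hμU : μ < U)
    (h1 : (1 + gapRho) * 16 * t < min μ (U - μ)) (h2 : (1 + gapRho) ^ 2 * 16 * (β * t ^ 2) < min μ (U - μ)) :
    ((β : ℂ), (μ : ℂ)) ∈ admissibleSetGap U t := by
  have hgap : gapOf U ((β : ℂ), (μ : ℂ)) = β * min μ (U - μ) := by
    unfold gapOf
    simp only [← Complex.ofReal_mul, Complex.ofReal_re, ← mul_sub]
    exact (mul_min_of_nonneg _ _ hβ.le).symm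
  have hΔ : 0 < min μ (U - μ) := lt_min hμ (by linarith)
  have hnorm : ‖(β : ℂ)‖ = β := by rw [Complex.norm_real, Real.norm_eq_abs, abs_of_pos hβ]
  refine ⟨?_, ?_, ?_, ?_, ?_⟩
  · show atomicPartitionFn (β : ℂ) (U : ℂ) (μ : ℂ) ≠ 0
    rw [atomicPartitionFn_ofReal]
    exact_mod_cast (atomicPartitionFnReal_pos β U μ).ne'
  · show siteRatio (β : ℂ) (U : ℂ) (μ : ℂ) < 2
    rw [siteRatio_ofReal]; norm_num
  · rw [hgap]; positivity
  · show (1 + gapRho) * 16 * (‖(β : ℂ)‖ * t) < gapOf U ((β : ℂ), (μ : ℂ))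
    rw [hgap, hnorm]
    calc (1 + gapRho) * 16 * (β * t) = β * ((1 + gapRho) * 16 * t) := by ring
      _ < β * min μ (U - μ) := mul_lt_mul_of_pos_left h1 hβ
  · show ((1 + gapRho) * (‖(β : ℂ)‖ * t)) ^ 2 * 16 < gapOf U ((β : ℂ), (μ : ℂ))
    rw [hgap, hnorm]
    calc ((1 + gapRho) * (β * t)) ^ 2 * 16 = β * ((1 + gapRho) ^ 2 * 16 * (β * t ^ 2)) := by ring
      _ < β * min μ (U - μ) := mul_lt_mul_of_pos_left h2 hβ

/-- **On the gapped admissible domain the lattice activity on `ℤ²` is a small translation-invariant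
activity** (`δ = 1`), for `t ≥ 0`. [cite: Ueltschi1999, Theorem 3.1 (domain D₂) via Proposition 2.2] -/
theorem isSmallTIActivity_of_mem_admissibleSetGap {U t : ℝ} (ht : 0 ≤ t) {z : ℂ × ℂ} (hz : z ∈ admissibleSetGap U t) :
    IsSmallTIActivity (latticeActivity 2 z.1 U z.2 (z.1 * t)) 1 := by
  obtain ⟨hz0, hr, hδ, h1, h2⟩ := hz
  have hτ : ‖z.1 * (t : ℂ)‖ = ‖z.1‖ * t := by rw [norm_mul, Complex.norm_real, Real.norm_eq_abs, abs_of_nonneg ht]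
  refine isSmallTIActivity_latticeActivity_of_gap hz0 hr.le hδ ?_ ?_
  · rw [hτ]; exact h1.le
  · rw [hτ]; exact h2.le

/-- **Analyticity of the polymer pressure of the Hubbard lattice activity in `(β, μ)` on the gapped
admissible domain** (`t ≥ 0`). [cite: Ueltschi1999, Theorem 3.1 (domain D₂: "the weights of polymers are analytic functions of β, μ, so is the free energy")] -/
theorem analyticOnNhd_polymerPressure_lattice_gap {U t : ℝ} (ht : 0 ≤ t) :
    AnalyticOnNhd ℂ (fun z : ℂ × ℂ => polymerPressure (latticeActivity 2 z.1 U z.2 (z.1 * t))) (admissibleSetGap U t) :=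
  analyticOnNhd_polymerPressure (isOpen_admissibleSetGap U t) (by norm_num)
    (fun A => (differentiableOn_latticeActivity (U : ℂ) (t : ℂ) A).mono fun z hz => hz.1)
    fun z hz => isSmallTIActivity_of_mem_admissibleSetGap ht hz

end AdmissibleGap

end Literature.MathematicalPhysics.QuantumLattice

end
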